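import Literature.MathematicalPhysics.QuantumFieldTheory.Balaban1983to89.T3MinimiserStabilityReduction
import Literature.MathematicalPhysics.QuantumFieldTheory.Balaban1983to89.T3PrintedRegularMinimiser
import Literature.MathematicalPhysics.QuantumFieldTheory.Balaban1983to89.T3PrintedMinimiserExistence
import Literature.MathematicalPhysics.QuantumFieldTheory.Balaban1983to89.T3LowerAlongMinimisersSplit
import Literature.MathematicalPhysics.QuantumFieldTheory.Balaban1983to89.T3UpperLiftSplit
import Literature.MathematicalPhysics.QuantumFieldTheory.Balaban1983to89.B12ContinuousTransportInvarianceOn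
import Literature.MathematicalPhysics.QuantumFieldTheory.Balaban1983to89.B10Eq5RegularAction
import Literature.MathematicalPhysics.QuantumFieldTheory.Balaban1983to89.B10Eq41TorusHistories

/-!
# LINES «monotone depth / Dini table for S2α′» (g16-1) + «competitor-surgery table for E» (g16-2) (seat ym-r3-idea-1, g16, lens «control») — skeleton v2

TARGET (a registered stub of the run-pair organ package, BY STATEMENT): S2α′ `RunPairOrgan.ClassicalPerHeight` of
`Cruxes/FluctuationComparisonRegPrIntL/Lines/runpair_organ.lean` (v9–v12; idea-crit-5 #207(a)/#223) — restated VERBATIM below as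
`ClassicalPerHeight` (the package module has no farm olean, so it cannot be imported; the two texts are identical and the bridge is
`Iff.rfl`) and PROVED from TWO new registered stubs by the kernel-checked glue `classicalPerHeight_of_monotone_equicontinuous`.
The leaf edge is the package's: `RunPairOrgan.yM3TorusSU2_of_classicalPerHeight` (package v13) turns any proof of this text, with the
package's other inputs {S1a, 26243, S2β, O1}, into the R3 leaf `…T3YM3TorusStatement.YM3TorusSU2` BY NAME.
No summit, rung or crux is proved by this file; `YM3TorusSU2` is NOT proved (two `sorry`d stubs M, E here; four more in the package).

THE IDEA (control lens: a monotone bounded quantity).  S2α′ asks, at every FIXED height `J`, that the tree-level parts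
`f_K := β_K · minActionRegPr F J K` of two runs `K ≤ K'` agree on Bałaban's window up to a null depth profile `A_J(K − J)` in 4-point
currency — a TWO-RUN CONVERGENCE statement (Cauchy in the depth), which print states for the propagators ([Balaban1985PropagatorsII]
(1.33)) but not verbatim for the non-linear constrained minimum.  This line manufactures the convergence from two inputs NEITHER of
which is a two-run convergence statement:
* M · `DepthMonotoneRegPr` — ONE-SIDED, RATE-FREE JENSEN MONOTONICITY IN THE DEPTH: `f_K(U) ≤ f_{K'}(U) + e_J(K − J)` for
  `J < K ≤ K'`, `e_J → 0`.  Mechanism: average the depth-`K'` printed-regular minimiser `u'` down to depth `K` with Bałaban's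
  averaging; the average lies in the depth-`K` printed-regular fibre of the same datum (fibre composition + regularity preservation on
  the window), and its `β_K`-weighted Wilson action is at most the `β_{K'}`-weighted action of `u'` up to a relative defect
  `O(θ_J L^{-2(K−J)})`: at the linearised (abelian) level the coarse plaquette field is `L^{2n}` times a weighted AVERAGE of the fine
  plaquette fields over block-surfaces (abelian Stokes), every fine plaquette receiving total weight `L^{-n}`, so CONVEXITY of `x²` gives
  `β_K Σ_p F̄_p² ≤ β_K L^{2n} L^{-n} Σ_q F_q² = β_{K'} Σ_q F_q²` EXACTLY (`β_{K+1} = Lβ_K`); the non-abelian / non-quadratic corrections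
  are quadratic in deviations of size `θ_J L^{-2(K−J)}`.  No expansion, no rate, no recovery sequence (the hard Γ-limsup direction of a
  Galerkin/Γ-convergence argument is never needed: convergence of a bounded almost-monotone sequence is free).
* E · `DepthEquicontinuousRegPr` — ONE-RUN, `k`-UNIFORM EQUICONTINUITY of `U ↦ f_K(U)` on the window in one-bond `dist1`-closeness
  (print: the background field `U_k(V)` is analytic in `V` on a `k`-uniform neighbourhood, [Balaban1985Variational] Thm 1 / Prop 8,
  and by the envelope theorem `∂_V f_K` is `β_K ×` the constraint multiplier, `k`-uniformly bounded).
* PROVED here: the a-priori bound `0 ≤ f_K ≤ 12 ε₀² L^{3m+4J}/γ` (every printed-regular fibre element has plaquettes within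
  `ε₀L^{-2(K−J)}` of `1`, `1 − Re tr ≤ ½ dist1²` ([Balaban1985UV3] (11)), `#Plaq = 24 L^{3(m+K)}`, `β_K = L^K/γ`; the junk value
  `sInf ∅ = 0` also obeys it), the abstract Dini lemma (almost-monotone + bounded ⇒ convergent), the Arzelà step (compactness of
  `SU(2)^{bonds}` + uniform equicontinuity ⇒ uniformly Cauchy on the window) and the 4-point bookkeeping (`A_J(n) := 4·sup`).
WHY EASIER THAN S2α′: M is a convexity inequality between two runs with NO analysis of the minimiser beyond regularity bookkeeping;
E is a statement about ONE run; the depth-Cauchy property of S2α′ is DERIVED.  WHY IT MIGHT FAIL: (M) Bałaban's averaging must map the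
depth-`K'` printed-regular fibre into the depth-`K` one INCLUDING the covariant-divergence clause `‖D*∂U‖ < ε₀L^{-3(K−J)}` (regularity
preservation with the SAME `ε₀` needs the window deep inside the regular regime: `θBal ≤ c(L)ε₀` at all heights, which the prefix
`∃ ε₁ ∀ ε₀ ∃ γ₁` grants via `T3ThresholdSmallness.exists_forall_θBal_le`), and print's fibres (6) must be NONEMPTY on the window at every
depth ([Balaban1985Variational] Thm 1 existence clause, tree schema `T3PrintedMinimiserExistence.Thm1MinimalIn8At`) — else the junk value
`0` breaks M and E alike (S2α′ carries the same implicit content); (E) the modulus must be uniform in the depth AND over the whole open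
window (constants of Thm 1 depend on `d, L` only — fine — but the minimal VALUE over the open space (6) must be attained in the interior,
located gap G-K1aR-2 `InfSixOfEightAt`).
DEAD LINES HONOURED: g5 #32 / #28′ killed one-sided / monotone-in-the-cutoff devices for LOOP EXPECTATIONS and exact quadratic (Whitney /
Galerkin-consistent) EMBEDDINGS of measures («no sign engine for SU(2)»; «lumped Wilson action misses consistency by an O(1) irrelevant
operator»).  Here the sign engine is convexity of the CLASSICAL energy under averaging (exact at the linearised level, computation above),
used only on the classical input S2α′ that the g15 stage table isolated; no embedding and no equality is claimed.  Nearest prior art in the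
cell: row (Fine_b) of `pub/ym-inputs/CFGCAUCHY-VARIATIONAL-p12g2.md` (two-sided Céa/Galerkin WITH RATE for the trunk's consecutive-run
`MinimiserStabilityRegPrAt`) and g8 #66 — the delta: one-sided, rate-free, arbitrary depth gaps, compactness in place of the lower
(strong-convexity) bound.
REGISTRY: NOT registered on 20520 (single-valued `skeleton` field; workfile, like the package).  v1: `lean check` rc 0, sorries = 2 (M, E).

v2 (g16, 2026-08-29T03:xxZ) — THE PLAIN FORMS.  (LINE g16-1 depth) M is DERIVED from the ONE-STEP stub M₁ `DepthMonotoneStep` (`K' = K + 1`,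
summable defect `d_J`) by PROVED telescoping (`depthMonotone_of_step`).  (LINE g16-2 «competitor-surgery table for E») E is DERIVED — with NO
analyticity, NO envelope theorem — from three variational stubs: E-N `RegFibreHalfNonempty` (Thm 1 existence at half radius on the window), E-I
`InteriorInfimum` (`inf` over print's `ε₀`-space `=` `inf` over the `ε₀/2`-space on the window: Prop 8 + located gap G-K1aR-2) and E-S
`CompetitorSurgery` (a half-radius competitor for `U` is pushed to a full-radius competitor for a `δ`-close `V` at action cost `≤ η`, uniformly in the
depth: Bałaban's local section of the averaging map, spread over the blocks), by the PROVED `depthEquicontinuous_of_surgery` (near-minimal competitor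
+ surgery + symmetry).  Composition `classicalPerHeight_of_tables : M₁ → E-N → E-I → E-S → S2α′` kernel-checked; `lean check` rc 0, sorries = 4
= {M₁, E-N, E-I, E-S}; `stub_depthMonotone`, `stub_depthEquicontinuous`, `classicalPerHeight_of_stubs` carry no `sorry` of their own.

v3 (g16, after idea-crit-5 #238 price (1)) — E-N AND E-I FROM THE TREE'S SCHEMAS BY NAME.  The displayed input P `PrintedMinimiserPackage` :=
`∀ L, ∃ a₀ a₁ B₃ > 0, T3PrintedMinimiserExistence.Thm1MinimalIn8At L a₁ B₃ ∧ InfSixOfEightAt L a₀ a₁ B₃` ([Balaban1985Variational] Thm 1's existence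
clause AS PRINTED ∧ the LEAD's located gap G-K1aR-2, counted once) REPLACES the stubs E-N, E-I, which are DERIVED (§7b:
`regFibreHalfNonempty_of_package`, `interiorInfimum_of_package` — thresholds `θ ≤ a₁`, `B₃θ ≤ ε₀/2` at every height by
`T3ThresholdSmallness.exists_forall_θBal_le`; the minimiser over (8) lies in the half-radius fibre by `regFibrePr_mono` and realises BOTH infima by
`minActionRegPr_eq_of_isMinOn`).  Table `classicalPerHeight_of_tables3 : M₁ → P → E-S → S2α′`; `lean check` rc 0, sorries = 3 = {M₁, P, E-S}.
The tree provenance of M₁ (= the LOWER direction of 19200's `minimiserStabilityRegPrAt_of_alongRegPrMinimisers`, re-set at fixed height; reader adapts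
`T3LowerAlongMinimisersSplit` / `T3CurvGradLog` / `T3SplitLog`) and THE DELTA (19200's UPPER direction / G-K1a-2′ `SmoothLiftAt` is never needed here)
are recorded on the card `Lines/monotone_depth_dini.md`.

v4 (g16) — M₁ ITSELF DERIVED: THE TREE'S LOWER COMPOSITION AT FIXED HEIGHT.  Displayed inputs now THREE: P⁺ `AveragingPackage` := per `L`, constants
with the FOUR books' schemas `Thm1MinimalIn8At ∧ InfSixOfEightAt ∧ T3LowerAlongMinimisersSplit.Prop1EmlAt ∧ AvgDivSmallAt` BY NAME (Thm 1's clause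
PRINTED; G-K1aR-2, G-K1a-5, G-K1a-3a located — all already stubs/schemas of crux K1 = stmt 19200, general in the height, used here at FIXED height);
D `DepthActionIneq` := the d = 3 averaging action inequality G-K1a-3b (`AvgActionIneqAt`) RE-SET at fixed datum height with a depth-SUMMABLE profile
(PRINTED IN KIND, [Federbush1987PhaseCellIII] Thm 4.3); E-S `CompetitorSurgery` (NEW).  PROVED: `depthMonotoneStep_of_package : P⁺ → D → M₁` (the
competitor = one-step average of Thm 1's deeper minimiser, admissible by the tree's `descendTo_mem_regFibrePr`, value identity by `InfSixOfEightAt` +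
`minActionRegPr_eq_of_isMinOn`, thresholds `θ ≤ min{a₁, ε₀/(2B₃), 1/(C₀B₃), c₂′/B₃}` by `exists_forall_θBal_le`), `printedMinimiserPackage_of_averaging`,
table `classicalPerHeight_of_tables4 : P⁺ → D → E-S → S2α′`.  `lean check` rc 0, sorries = 3 = {P⁺, D, E-S}; BC7 vs the leaf: P⁺ CLEAN, D CLEAN
(P1/P2/P2h/P3/P5 ok).  NEW CONTENT of the two g16 lines = {D (printed in kind), E-S}; everything else is by-name books items + PROVED glue.

v5 (g16) — D ITSELF DERIVED from a PER-CONFIGURATION schema of pure lattice geometry: D′ `AvgActionContractionAt L C₂ c` (packaged as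
`ContractionPackage`): for every configuration on the finest lattice of run `K+1` with plaquettes within `a ≤ c` of `1`, `A(D_{K,K+1}U) ≤
L·A(U) + C₂a³·L^{3(m+K)}` — no minimiser, no datum, no height; the same statement serves K1's located gap G-K1a-3b at the moving height.
PROVED: `beta_mul_cubic_le` (fixed-height power counting: `β_K·C₂a³L^{3(m+K)} ≤ C₂B₃³θ_J³γ⁻¹L^{3m+4J}·L^{−2(K−J)}`, geometric in the depth, no
`m ≥ 3`), `depthActionIneq_of_contraction : D′ → D` (D's minimising hypothesis is not even used), table `classicalPerHeight_of_tables5 : P⁺ →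
D′ → E-S → S2α′`.  `lean check` rc 0, sorries = 3 = {P⁺, D′, E-S}; BC7 vs the leaf: D′ CLEAN.  The reader of D′ ports [Federbush1987PhaseCellIII]
Thm 4.3 (4.5) to the (0.4) averaging and the Wilson action (exactly quadratic in the plaquette deviation on `SU(2)`): Cauchy–Schwarz over the
lattice-Stokes telescoping with the count «each fine plaquette met `L²` times» for the factor `L`, Prop 1 (51)-type corrections for `C₂a³`.
BONUS for crux K1 (stmt-QuantumFields-19200, §7e, PROVED): `avgActionIneqAt_of_contraction` — D′ ⇒ the tree's located gap G-K1a-3b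
`T3LowerAlongMinimisersSplit.AvgActionIneqAt F γ b₀ p₀ m ε₀ B₃` at the MOVING height for `m ≥ 10` under the prefix (`K₀ = 0`, radii
`C₂B₃³L^{3m}γ⁻¹(√(1/L))^K`), so K1's LOWER direction rests on `Prop1EmlAt ∧ AvgDivSmallAt ∧ D′` + print: ONE per-configuration schema for both roads.
-/

open MeasureTheory Filter Topology
open Literature.MathematicalPhysics.QuantumFieldTheory.Balaban1983to89 T3ContinuumYM3Torus
  T3UnitLawDensityEML T3UnitScaleTilt T3PrintedRegularMinimiser

namespace Summit.QuantumFields.YangMills.Cruxes.FluctuationComparisonRegPrIntL.RunPairOrgan.MonotoneDepth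

/-! ## §1 The statements -/

/-- S2α′ · CLASSICAL PER-HEIGHT EQUILIBRATION — text VERBATIM = `RunPairOrgan.ClassicalPerHeight` (package `Lines/runpair_organ.lean` v9–v12):
at every fixed height `J` the 4-point window discrepancy of `β_K · minActionRegPr F J K` between two runs `K ≤ K'` is bounded by a null
depth profile `A_J (K − J)`.  [Balaban1985Variational] Thm 1, [Balaban1985PropagatorsII] (1.33) (for the quadratic part). -/
def ClassicalPerHeight : Prop :=
  ∀ (L : ℕ) (b₀ p₀ : ℝ), 0 < b₀ → 0 < p₀ → ∃ ε₁ : ℝ, 0 < ε₁ ∧ ∀ (ε₀ : ℝ), 0 < ε₀ → ε₀ ≤ ε₁ →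
    ∃ γ₁ : ℝ, 0 < γ₁ ∧ ∀ (F : T3Family) (γ : ℝ), F.L = L → 0 < γ → γ ≤ γ₁ →
      ∀ J : ℕ, ∃ A : ℕ → ℝ, (∀ n, 0 ≤ A n) ∧ Tendsto A atTop (𝓝 0) ∧
        ∀ (K K' : ℕ) (hJK : J ≤ K) (hJK' : J ≤ K'), K ≤ K' →
          ∀ (b b' : PBond (F.P J) 0) (U V W Z : GaugeField (F.P J) 0 (Matrix.specialUnitaryGroup (Fin 2) ℂ)),
            PlaqSmall (θBal F.L γ b₀ p₀ J) U → PlaqSmall (θBal F.L γ b₀ p₀ J) V →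
            PlaqSmall (θBal F.L γ b₀ p₀ J) W → PlaqSmall (θBal F.L γ b₀ p₀ J) Z →
            (∀ e, e ≠ b → U e = V e) → (∀ e, e ≠ b' → U e = W e) → (∀ e, e ≠ b' → V e = Z e) → (∀ e, e ≠ b → W e = Z e) →
            |((F.scheme ℰp γ).β K * minActionRegPr F J K hJK ε₀ U - (F.scheme ℰp γ).β K' * minActionRegPr F J K' hJK' ε₀ U)
              - ((F.scheme ℰp γ).β K * minActionRegPr F J K hJK ε₀ V - (F.scheme ℰp γ).β K' * minActionRegPr F J K' hJK' ε₀ V)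
              - (((F.scheme ℰp γ).β K * minActionRegPr F J K hJK ε₀ W - (F.scheme ℰp γ).β K' * minActionRegPr F J K' hJK' ε₀ W)
                - ((F.scheme ℰp γ).β K * minActionRegPr F J K hJK ε₀ Z - (F.scheme ℰp γ).β K' * minActionRegPr F J K' hJK' ε₀ Z))|
              ≤ A (K - J)

/-- M · ONE-SIDED JENSEN MONOTONICITY IN THE DEPTH (M; NEW): under S2α′'s prefix, at every height `J` there is a null defect profile
`e_J ≥ 0` with `β_K · minActionRegPr F J K U ≤ β_{K'} · minActionRegPr F J K' U + e_J (K − J)` for all `J < K ≤ K'` and every window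
datum `U`.  Mechanism: Bałaban-average the depth-`K'` printed-regular minimiser down to depth `K` (a depth-`K` printed-regular competitor
for the same datum — fibre composition + regularity preservation on the window) and compare actions by CONVEXITY: at the linearised level
`β_K Σ_p F̄_p² ≤ β_{K'} Σ_q F_q²` exactly (coarse plaquette = `L^{2n}` × a weighted average of fine plaquettes over block surfaces, each fine
plaquette carrying total weight `L^{-n}`, `β_{K'} = L^{n} β_K`); non-abelian / non-quadratic corrections are of relative size
`O(θ_J L^{-2(K−J)})`, times the a-priori bound `12ε₀²L^{3m+4J}/γ`.  Printed ingredients: [Balaban1985Averaging] (15)–(19) (averaging,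
composition), [Balaban1985Variational] (2)–(8) + Thm 1 (regular spaces, existence on the window), [Balaban1985UV3] (11).
Why it might fail: the averaged minimiser must satisfy print's covariant-divergence clause `‖D*∂U‖ < ε₀L^{-3(K−J)}` at depth `K` with the
SAME `ε₀`, and the fibres (6) must be nonempty on the whole window at every depth (junk `sInf ∅ = 0` otherwise). -/
def DepthMonotoneRegPr : Prop :=
  ∀ (L : ℕ) (b₀ p₀ : ℝ), 0 < b₀ → 0 < p₀ → ∃ ε₁ : ℝ, 0 < ε₁ ∧ ∀ (ε₀ : ℝ), 0 < ε₀ → ε₀ ≤ ε₁ →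
    ∃ γ₁ : ℝ, 0 < γ₁ ∧ ∀ (F : T3Family) (γ : ℝ), F.L = L → 0 < γ → γ ≤ γ₁ →
      ∀ J : ℕ, ∃ e : ℕ → ℝ, (∀ n, 0 ≤ e n) ∧ Tendsto e atTop (𝓝 0) ∧
        ∀ (K K' : ℕ) (hJK : J < K) (hJK' : J < K'), K ≤ K' →
          ∀ U : GaugeField (F.P J) 0 (Matrix.specialUnitaryGroup (Fin 2) ℂ), PlaqSmall (θBal F.L γ b₀ p₀ J) U →
            (F.scheme ℰp γ).β K * minActionRegPr F J K hJK.le ε₀ U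
              ≤ (F.scheme ℰp γ).β K' * minActionRegPr F J K' hJK'.le ε₀ U + e (K - J)

/-- E · DEPTH-UNIFORM EQUICONTINUITY ON THE WINDOW (M–L; NEW): under S2α′'s prefix, at every height `J` the family
`{U ↦ β_K · minActionRegPr F J K U}_{K > J}` is uniformly equicontinuous on Bałaban's window in one-bond `dist1`-closeness:
`∀ η > 0 ∃ δ > 0 ∀ K > J ∀ U V` in the window, `(∀ b, dist1 ((U b)⁻¹ V b) < δ) ⇒ |f_K U − f_K V| ≤ η`.  Print: the background field
`U_k(V)` is analytic in `V` on a neighbourhood uniform in `k` with `k`-uniform bounds ([Balaban1985Variational] Thm 1, Prop 8 p.304,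
propagators [Balaban1985PropagatorsII]); envelope theorem: `∂_V (β_K min A) = β_K ×` (constraint multiplier), `k`-uniformly bounded on the
window.  Why it might fail: uniformity over the whole OPEN window needs the minimum over print's open space (6) attained in the interior at
every depth (located gap G-K1aR-2, tree schema `T3PrintedMinimiserExistence.InfSixOfEightAt`), and again nonempty fibres. -/
def DepthEquicontinuousRegPr : Prop :=
  ∀ (L : ℕ) (b₀ p₀ : ℝ), 0 < b₀ → 0 < p₀ → ∃ ε₁ : ℝ, 0 < ε₁ ∧ ∀ (ε₀ : ℝ), 0 < ε₀ → ε₀ ≤ ε₁ →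
    ∃ γ₁ : ℝ, 0 < γ₁ ∧ ∀ (F : T3Family) (γ : ℝ), F.L = L → 0 < γ → γ ≤ γ₁ →
      ∀ J : ℕ, ∀ η : ℝ, 0 < η → ∃ δ : ℝ, 0 < δ ∧
        ∀ (K : ℕ) (hJK : J < K) (U V : GaugeField (F.P J) 0 (Matrix.specialUnitaryGroup (Fin 2) ℂ)),
          PlaqSmall (θBal F.L γ b₀ p₀ J) U → PlaqSmall (θBal F.L γ b₀ p₀ J) V →
          (∀ b : PBond (F.P J) 0, dist1 ((U b)⁻¹ * V b) < δ) →
            |(F.scheme ℰp γ).β K * minActionRegPr F J K hJK.le ε₀ U - (F.scheme ℰp γ).β K * minActionRegPr F J K hJK.le ε₀ V| ≤ η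

/-! ### §1b (v2, LINE g16-1 depth + LINE g16-2) The plain forms: ONE-STEP monotonicity for M; the competitor-surgery table for E -/

/-- M₁ · ONE-STEP JENSEN MONOTONICITY (M; v2 — the plain form of M): under S2α′'s prefix, at every height `J` a SUMMABLE defect profile
`d_J ≥ 0` with `β_K · minActionRegPr F J K U ≤ β_{K+1} · minActionRegPr F J (K+1) U + d_J (K − J)` for all `K > J` and window data `U`
(ONE averaging step: the depth-`K+1` printed-regular minimiser averaged once is a depth-`K` competitor; Jensen for one `L`-block).  M follows by
telescoping with `e_J(n) := Σ_{m ≥ n} d_J(m)` (PROVED, `depthMonotone_of_step`).  Heuristic size `d_J(n) ≲ C(L)·12ε₀²L^{3m+4J}γ⁻¹·θ_J·L^{-2n}`.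
Why it might fail: as M (covariant-divergence clause of the averaged minimiser with the same `ε₀`; nonempty fibres). [Balaban1985Averaging] (15)–(19),
[Balaban1985Variational] (2)–(8), [Balaban1985UV3] (11). -/
def DepthMonotoneStep : Prop :=
  ∀ (L : ℕ) (b₀ p₀ : ℝ), 0 < b₀ → 0 < p₀ → ∃ ε₁ : ℝ, 0 < ε₁ ∧ ∀ (ε₀ : ℝ), 0 < ε₀ → ε₀ ≤ ε₁ →
    ∃ γ₁ : ℝ, 0 < γ₁ ∧ ∀ (F : T3Family) (γ : ℝ), F.L = L → 0 < γ → γ ≤ γ₁ →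
      ∀ J : ℕ, ∃ d : ℕ → ℝ, (∀ n, 0 ≤ d n) ∧ Summable d ∧
        ∀ (K : ℕ) (hJK : J < K) (U : GaugeField (F.P J) 0 (Matrix.specialUnitaryGroup (Fin 2) ℂ)),
          PlaqSmall (θBal F.L γ b₀ p₀ J) U →
            (F.scheme ℰp γ).β K * minActionRegPr F J K hJK.le ε₀ U
              ≤ (F.scheme ℰp γ).β (K + 1) * minActionRegPr F J (K + 1) (Nat.le_succ_of_le hJK.le) ε₀ U + d (K - J)

/-- E-N · NONEMPTY HALF-RADIUS FIBRES ON THE WINDOW (S–M; the existence clause of [Balaban1985Variational] Thm 1, tree schema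
`T3PrintedMinimiserExistence.Thm1MinimalIn8At`): under S2α′'s prefix, for every `K > J` and every window datum `U` the printed-regular fibre
at HALF radius `regFibrePr F J K (ε₀/2) U` is nonempty (Bałaban's minimiser `U_k(V)` is regular with constant `O(θ_J) ≤ ε₀/2` once
`θBal ≤ c(L)ε₀`, which the prefix grants).  Why it might fail: only if Thm 1's existence radius is not uniform in the depth. -/
def RegFibreHalfNonempty : Prop :=
  ∀ (L : ℕ) (b₀ p₀ : ℝ), 0 < b₀ → 0 < p₀ → ∃ ε₁ : ℝ, 0 < ε₁ ∧ ∀ (ε₀ : ℝ), 0 < ε₀ → ε₀ ≤ ε₁ →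
    ∃ γ₁ : ℝ, 0 < γ₁ ∧ ∀ (F : T3Family) (γ : ℝ), F.L = L → 0 < γ → γ ≤ γ₁ →
      ∀ (J K : ℕ) (hJK : J < K) (U : GaugeField (F.P J) 0 (Matrix.specialUnitaryGroup (Fin 2) ℂ)),
        PlaqSmall (θBal F.L γ b₀ p₀ J) U → (regFibrePr F J K hJK.le (ε₀ / 2) U).Nonempty

/-- E-I · INTERIOR INFIMUM (M; [Balaban1985Variational] Prop 8 p.304 «a critical point in the space (8) lies in the space with constants a₅·…»
+ the located gap G-K1aR-2 `InfSixOfEightAt` (the infimum over print's open space is approached from the interior)): under S2α′'s prefix, on the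
window the printed-regular minimum at radius `ε₀` equals the one at radius `ε₀/2`, at every depth `K > J`.  Why it might fail: the infimum over
the `ε₀`-space could be approached only along configurations whose divergence clause saturates (no interior near-minimisers) if the window
were not deep inside the regular regime — excluded by `θBal ≤ c(L)ε₀`, but NOT PRINTED as an infimum statement. -/
def InteriorInfimum : Prop :=
  ∀ (L : ℕ) (b₀ p₀ : ℝ), 0 < b₀ → 0 < p₀ → ∃ ε₁ : ℝ, 0 < ε₁ ∧ ∀ (ε₀ : ℝ), 0 < ε₀ → ε₀ ≤ ε₁ →
    ∃ γ₁ : ℝ, 0 < γ₁ ∧ ∀ (F : T3Family) (γ : ℝ), F.L = L → 0 < γ → γ ≤ γ₁ →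
      ∀ (J K : ℕ) (hJK : J < K) (U : GaugeField (F.P J) 0 (Matrix.specialUnitaryGroup (Fin 2) ℂ)),
        PlaqSmall (θBal F.L γ b₀ p₀ J) U →
          minActionRegPr F J K hJK.le ε₀ U = minActionRegPr F J K hJK.le (ε₀ / 2) U

open Literature.MathematicalPhysics.QuantumFieldTheory.Balaban1983to89.T3PrintedMinimiserExistence in
/-- P · THE PRINTED-MINIMISER PACKAGE BY NAME (v3; replaces E-N ∧ E-I as the displayed input, both DERIVED from it in §7b): for every block
size `L`, constants `a₀ a₁ B₃ > 0` with [Balaban1985Variational] Thm 1's EXISTENCE CLAUSE AS PRINTED — tree schema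
`T3PrintedMinimiserExistence.Thm1MinimalIn8At L a₁ B₃` (for every `ε₁ ≤ a₁`-small datum and every depth `n < K`, the Wilson action attains its
minimum over print's small space (8) of radius `B₃ε₁`) — and the LEAD's located gap G-K1aR-2 — tree schema `InfSixOfEightAt L a₀ a₁ B₃` (that
minimiser minimises over the big space (6) of every radius `ε₀ ∈ [B₃ε₁, a₀]`; counted ONCE with the LEAD's item).  (For `L ≤ 1` both schemas are
vacuous: no `T3Family` has `F.L ≤ 1`.)  Why it might fail: G-K1aR-2 is NOT PRINTED as an infimum statement (cell DIVERGENCE D-B11-2). -/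
def PrintedMinimiserPackage : Prop :=
  ∀ L : ℕ, ∃ a₀ a₁ B₃ : ℝ, 0 < a₀ ∧ 0 < a₁ ∧ 0 < B₃ ∧ Thm1MinimalIn8At L a₁ B₃ ∧ InfSixOfEightAt L a₀ a₁ B₃

open Literature.MathematicalPhysics.QuantumFieldTheory.Balaban1983to89.T3PrintedMinimiserExistence
  Literature.MathematicalPhysics.QuantumFieldTheory.Balaban1983to89.T3LowerAlongMinimisersSplit in
/-- P⁺ · THE PRINTED/LOCATED MINIMISER-AND-AVERAGING PACKAGE BY NAME (v4; the displayed input from which P, E-N, E-I AND the admissibility half of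
M₁ are DERIVED): per block size `L`, constants `a₀ a₁ B₃ C₀ c₂′ > 0` with FOUR tree schemas — `Thm1MinimalIn8At` ([Balaban1985Variational] Thm 1's
existence clause, PRINTED), `InfSixOfEightAt` (located gap G-K1aR-2, the LEAD's), `T3LowerAlongMinimisersSplit.Prop1EmlAt` ([Balaban1985Averaging]
Prop 1 (51) for the family's (0.4)-averaging, cell gap G-K1a-5) and `T3LowerAlongMinimisersSplit.AvgDivSmallAt` (the divergence clause of the
averaged minimiser, located gap G-K1a-3a; PROVED in the tree under the log schema `T3CurvGradLog.MinimiserCurvGradLogAt` = Thm 1 (9)–(10)).  All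
four are schemas ALREADY ON THE BOOKS of crux K1 (stmt-QuantumFields-19200's LOWER/EXIST stubs), general in the height `n < K` — usable at FIXED
height verbatim.  Why it might fail: G-K1aR-2 and G-K1a-3a are located, not printed. -/
def AveragingPackage : Prop :=
  ∀ L : ℕ, ∃ a₀ a₁ B₃ C₀ c₂' : ℝ, 0 < a₀ ∧ 0 < a₁ ∧ 0 < B₃ ∧ 0 < C₀ ∧ 0 < c₂' ∧
    Thm1MinimalIn8At L a₁ B₃ ∧ InfSixOfEightAt L a₀ a₁ B₃ ∧ Prop1EmlAt L C₀ c₂' ∧ AvgDivSmallAt L a₀ a₁ B₃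

open Literature.MathematicalPhysics.QuantumFieldTheory.Balaban1983to89.T3TiltDescent in
/-- D · THE d = 3 AVERAGING ACTION INEQUALITY AT FIXED HEIGHT (v4; M; the located gap G-K1a-3b `T3LowerAlongMinimisersSplit.AvgActionIneqAt` RE-SET from
the moving height `⌊K/m⌋` to a FIXED datum height `J`, with a depth profile `d_J` SUMMABLE IN THE DEPTH): for every radius constant `B₃ > 0`, under
S2α′'s prefix, at every height `J`: `β_K·A(D_{K,K+1}u′) ≤ β_{K+1}·A(u′) + d_J(K − J)` for every window datum `U`, every depth `K > J` and every
minimiser `u′` of the Wilson action over print's space (6)(ε₀) of depth `K+1` lying in (8) (radius `B₃θ_J`).  Quadratic part: `A_K(ū′) ≤ L·A_{K+1}(u′)`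
by Cauchy–Schwarz over the `L²` translated plaquettes (no loss; `β_{K+1} = Lβ_K`); cubic corrections `β_{K+1}·24L^{3(m+K+1)}·(B₃θ_JL^{-2(K+1−J)})³ ≲
B₃³θ_J³L^{3m+4J}γ⁻¹·L^{-2(K−J)}` — GEOMETRIC in the depth at fixed `J` (the moving-height version needs `m ≥ 3`).  PRINTED IN KIND: [Federbush1987PhaseCellIII]
Thm 4.3 (4.5) for Federbush's averaging (tree `Federbush1986.LocalStabilitySUN.eq525_family_SUN`); for (0.4)/Wilson NOT printed (PORT).  Why it might
fail: the (0.4)-averaging is not an exact `L²`-contraction on plaquette variables beyond the quadratic order; the signed Gaussian column of the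
instrument row (idea-crit-5 #237/#238 (2)) tests the quadratic level (`d = 0` there). -/
def DepthActionIneq : Prop :=
  ∀ (L : ℕ) (b₀ p₀ B₃ : ℝ), 0 < b₀ → 0 < p₀ → 0 < B₃ → ∃ ε₁ : ℝ, 0 < ε₁ ∧ ∀ (ε₀ : ℝ), 0 < ε₀ → ε₀ ≤ ε₁ →
    ∃ γ₁ : ℝ, 0 < γ₁ ∧ ∀ (F : T3Family) (γ : ℝ), F.L = L → 0 < γ → γ ≤ γ₁ →
      ∀ J : ℕ, ∃ d : ℕ → ℝ, (∀ n, 0 ≤ d n) ∧ Summable d ∧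
        ∀ (K : ℕ) (hJK : J < K) (U : GaugeField (F.P J) 0 (Matrix.specialUnitaryGroup (Fin 2) ℂ)),
          PlaqSmall (θBal F.L γ b₀ p₀ J) U →
            ∀ u' ∈ regFibrePr F J (K + 1) (Nat.le_succ_of_le hJK.le) (B₃ * θBal F.L γ b₀ p₀ J) U,
              IsMinOn (fun W : GaugeField (F.P (K + 1)) 0 (Matrix.specialUnitaryGroup (Fin 2) ℂ) => wilsonAction4 W)
                  (regFibrePr F J (K + 1) (Nat.le_succ_of_le hJK.le) ε₀ U) u' →
                (F.scheme ℰp γ).β K * wilsonAction4 (descendTo F ℰp K (K + 1) (Nat.le_succ K) u') ≤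
                  (F.scheme ℰp γ).β (K + 1) * wilsonAction4 u' + d (K - J)

/-- E-S · COMPETITOR SURGERY (M; NEW as a statement — the variational replacement for analyticity in E): under S2α′'s prefix, at every height
`J`, for every `η > 0` there is `δ > 0` such that for all depths `K > J`, all window data `U, V` that are `δ`-close in every bond, and every
HALF-radius printed-regular `u` in the fibre of `U`, there is a FULL-radius printed-regular `v` in the fibre of `V` with
`β_K A(v) ≤ β_K A(u) + η`.  Mechanism: `v := u ·` (Bałaban's local right inverse of the averaging map applied to the coarse change `U → V`,
spread smoothly over the blocks: [Balaban1985Averaging] (15)–(19), the minimal-extension operators of [Balaban1985PropagatorsI]); the fine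
plaquettes move by `O(δL^{-2(K−J)})` — inside the regularity margin `ε₀/2 · L^{-2(K−J)}` for `δ ≤ c ε₀` — on `O(L^{3(K−J)})` plaquettes per block,
so `β_K ΔA ≲ (L^J/γ)(θ_J δ + δ²)·#bonds_J`, UNIFORM IN `K` (abelian model: exact minimal-extension computation).  Why it might fail: the
depth-uniform section of the `(K−J)`-fold averaging (the spread must be smooth on scale `L^{K−J}`: the clause (7) is `‖D*F‖ < ε₀L^{-3(K−J)}`,
the covariant divergence OF THE CURVATURE — gauge-covariant, `T3AvgDivergenceSplit.divSmall_of_plaqSmall` — so `F` may move by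
`O(δL^{-2(K−J)})` and `D*F` by `O(δL^{-3(K−J)})`, inside `u`'s half-radius margins), and data `U, V` near the window's edge. -/
def CompetitorSurgery : Prop :=
  ∀ (L : ℕ) (b₀ p₀ : ℝ), 0 < b₀ → 0 < p₀ → ∃ ε₁ : ℝ, 0 < ε₁ ∧ ∀ (ε₀ : ℝ), 0 < ε₀ → ε₀ ≤ ε₁ →
    ∃ γ₁ : ℝ, 0 < γ₁ ∧ ∀ (F : T3Family) (γ : ℝ), F.L = L → 0 < γ → γ ≤ γ₁ →
      ∀ J : ℕ, ∀ η : ℝ, 0 < η → ∃ δ : ℝ, 0 < δ ∧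
        ∀ (K : ℕ) (hJK : J < K) (U V : GaugeField (F.P J) 0 (Matrix.specialUnitaryGroup (Fin 2) ℂ)),
          PlaqSmall (θBal F.L γ b₀ p₀ J) U → PlaqSmall (θBal F.L γ b₀ p₀ J) V →
          (∀ b : PBond (F.P J) 0, dist1 ((U b)⁻¹ * V b) < δ) →
            ∀ u ∈ regFibrePr F J K hJK.le (ε₀ / 2) U, ∃ v ∈ regFibrePr F J K hJK.le ε₀ V,
              (F.scheme ℰp γ).β K * wilsonAction4 v ≤ (F.scheme ℰp γ).β K * wilsonAction4 u + η

open Literature.MathematicalPhysics.QuantumFieldTheory.Balaban1983to89.T3TiltDescent in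
/-- D′ · THE PER-CONFIGURATION (0.4)-AVERAGING ACTION CONTRACTION (v5; pure lattice geometry — no variational problem, no minimiser, no
datum, no height; the SAME statement serves crux K1's located gap G-K1a-3b `T3LowerAlongMinimisersSplit.AvgActionIneqAt` at the moving height
and THIS line's D at fixed height): at given constants `C₂ ≥ 0`, `c > 0`, for every configuration `U` on the finest lattice of run `K+1`
with all plaquette variables within `a ≤ c` of `1`, the Wilson action of its one-step (0.4)-average is at most `L = L^{4−d}` times its own,
up to `C₂·a³` per coarse plaquette: `A(D_{K,K+1}U) ≤ L·A(U) + C₂a³·L^{3(m+K)}`.  WHY PLAUSIBLY TRUE: the Wilson action is EXACTLY quadratic in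
the plaquette deviation (`1 − ½Re tr W = ¼‖W − 1‖²` on `SU(2)`); at linear order the coarse plaquette deviation is the average, over the
block positions, of lattice-Stokes sums of `L²` conjugated fine plaquette deviations (telescoping `V₁⋯V_N − 1 = Σᵢ V₁⋯V_{i−1}(Vᵢ − 1)`,
unitary prefactors), so Cauchy–Schwarz in the Frobenius space and the count «each fine plaquette is met `L²` times» give the quadratic part
with the factor `L⁴·L^{−5}·L² = L` and NO loss (abelian caricature: `dQ = Q⁽²⁾d` with a POSITIVE plaquette-averaging `Q⁽²⁾` of row sum `L²`,
column sum `L^{−1}` — Schur); the corrections ([Balaban1985Averaging] Prop 1 (51)'s `C₀(L²a)²` in the deviation) enter the square at order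
`a·a² = a³` per coarse plaquette.  PRINTED IN KIND for Federbush's averaging: [Federbush1987PhaseCellIII] Thm 4.3 (4.5) «coarse ≤ N^{4−d}·fine +
f₂(Σ|A_{∂p}|²)^{3/2}» (tree `Federbush1986.LocalStabilitySUN.eq525_family_SUN`); for (0.4)/Wilson a PORT (cell gap G-K1a-3).  Why it might
fail: the transports to block centres in (0.4) make the linearised plaquette-averaging SIGNED; if its `ℓ² → ℓ²` norm exceeds `√L` the exact
factor `L` is lost (then only `(1 + O(a))·L`, useless for monotonicity) — the SIGNED/`jensen_n` column of the instrument row decides it. -/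
def AvgActionContractionAt (L : ℕ) (C₂ c : ℝ) : Prop :=
  ∀ F : T3Family, F.L = L → ∀ (K : ℕ) (a : ℝ), 0 < a → a ≤ c →
    ∀ U : GaugeField (F.P (K + 1)) 0 (Matrix.specialUnitaryGroup (Fin 2) ℂ), PlaqSmall a U →
      wilsonAction4 (descendTo F ℰp K (K + 1) (Nat.le_succ K) U) ≤
        (L : ℝ) * wilsonAction4 U + C₂ * a ^ 3 * (L : ℝ) ^ (3 * (F.m + K))

/-- D′ packaged per block size: `∀ L, ∃ C₂ ≥ 0, ∃ c > 0, AvgActionContractionAt L C₂ c` (v5's displayed input replacing D). -/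
def ContractionPackage : Prop :=
  ∀ L : ℕ, ∃ C₂ c : ℝ, 0 ≤ C₂ ∧ 0 < c ∧ AvgActionContractionAt L C₂ c

/-! ## §2 The registered stubs (v5: THREE — P⁺, D′, E-S; P, E-N, E-I (§7b), D (§7d), M₁ (§7c′), M, E, S2α′ (§8) are DERIVED) -/

/-- STUB P⁺ (books items BY NAME: Thm 1's clause PRINTED; G-K1aR-2, G-K1a-5, G-K1a-3a located, on 19200's books) — the package. -/
theorem stub_averagingPackage : AveragingPackage := by
  sorry

/-- STUB D′ (M; G-K1a-3 per configuration, PORT of [Federbush1987PhaseCellIII] Thm 4.3 to (0.4)/Wilson) — the averaging action contraction. -/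
theorem stub_contractionPackage : ContractionPackage := by
  sorry

/-- STUB E-S (M) — competitor surgery. -/
theorem stub_competitorSurgery : CompetitorSurgery := by
  sorry

/-! ## §3 PROVED: the a-priori bound `β_K · minActionRegPr F J K U ≤ 12 ε₀² L^{3m+4J} / γ` -/

/-- Every printed-regular fibre element at depth `K = J + d` has plaquettes within `ε₀L^{-2d}` of `1`, hence (by `1 − Re tr ≤ ½ dist1²`,
[Balaban1985UV3] (11)) Wilson action `≤ #Plaq · ½ε₀²L^{-4d}` with `#Plaq = 24L^{3(m+J+d)}`; times `β_{J+d} = L^{J+d}/γ` this is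
`12ε₀²L^{3m+4J}/γ`, INDEPENDENT OF THE DEPTH.  The junk value `sInf ∅ = 0` obeys the same bound. [cite: Balaban1985UV3, (11) p.258] -/
theorem beta_mul_minActionRegPr_le (F : T3Family) {γ : ℝ} (hγ : 0 < γ) (ε₀ : ℝ) (J d : ℕ)
    (U : GaugeField (F.P J) 0 (Matrix.specialUnitaryGroup (Fin 2) ℂ)) :
    (F.scheme ℰp γ).β (J + d) * minActionRegPr F J (J + d) (Nat.le_add_right J d) ε₀ U
      ≤ 12 * ε₀ ^ 2 * (F.L : ℝ) ^ (3 * F.m + 4 * J) / γ := by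
  have hL : (1 : ℝ) < F.L := by exact_mod_cast F.hL.2
  have hL0 : (0 : ℝ) < F.L := zero_lt_one.trans hL
  have hβ : (F.scheme ℰp γ).β (J + d) = (γ * ((F.L : ℝ)⁻¹) ^ (J + d))⁻¹ := rfl
  have hβ0 : 0 ≤ (F.scheme ℰp γ).β (J + d) := F.scheme_β_nonneg ℰp hγ.le _
  have hsite : Fintype.card (Site (F.P (J + d)) 0) = (2 * F.L ^ (F.m + (J + d))) ^ 3 := by
    rw [show Fintype.card (Site (F.P (J + d)) 0) = Fintype.card (Fin 3 → ZMod ((F.P (J + d)).sitesPerDir 0)) from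
      Fintype.card_congr (Equiv.refl _)]
    rw [Fintype.card_fun, ZMod.card, Fintype.card_fin]
    simp [Params.sitesPerDir]
  have hplaq : (Fintype.card (Plaq (F.P (J + d)) 0) : ℝ) = 24 * (F.L : ℝ) ^ (3 * F.m + 3 * J + 3 * d) := by
    rw [B10Eq41TorusHistories.card_plaq_three (F.P_d (J + d)) 0, hsite]
    push_cast
    ring
  have hA : ∀ U' ∈ regFibrePr F J (J + d) (Nat.le_add_right J d) ε₀ U,
      wilsonAction4 U' ≤ (Fintype.card (Plaq (F.P (J + d)) 0) : ℝ) * ((1 / 2) * (ε₀ * ((F.L : ℝ)⁻¹) ^ (2 * d)) ^ 2) := by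
    intro U' hU'
    have hreg : PlaqSmall (T3RegularMinimiser.regThreshold F J (J + d) ε₀) U' := ((mem_regFibrePr_iff F).mp hU').2.plaqSmall
    have ht : T3RegularMinimiser.regThreshold F J (J + d) ε₀ = ε₀ * ((F.L : ℝ)⁻¹) ^ (2 * d) := by
      show ε₀ * ((F.L : ℝ)⁻¹) ^ (2 * (J + d - J)) = _
      rw [Nat.add_sub_cancel_left]
    unfold wilsonAction4 wilsonAction
    calc ∑ p : Plaq (F.P (J + d)) 0, (1 : ℝ) * (1 - reTr (GaugeField.plaqHol U' p))
        ≤ ∑ p : Plaq (F.P (J + d)) 0, (1 / 2) * (ε₀ * ((F.L : ℝ)⁻¹) ^ (2 * d)) ^ 2 := by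
          refine Finset.sum_le_sum fun p _ => ?_
          rw [one_mul]
          have h1 := B10Eq5RegularAction.one_sub_reTr_le_specialUnitaryGroup (GaugeField.plaqHol U' p)
          have h2 : dist1 (GaugeField.plaqHol U' p) < ε₀ * ((F.L : ℝ)⁻¹) ^ (2 * d) := ht ▸ hreg p
          have h3 : 0 ≤ dist1 (GaugeField.plaqHol U' p) := GaugeGroup.dist1_nonneg _
          nlinarith [h1, h2, h3, sq_nonneg (dist1 (GaugeField.plaqHol U' p)), mul_self_le_mul_self h3 h2.le]
      _ = (Fintype.card (Plaq (F.P (J + d)) 0) : ℝ) * ((1 / 2) * (ε₀ * ((F.L : ℝ)⁻¹) ^ (2 * d)) ^ 2) := by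
          rw [Finset.sum_const, Finset.card_univ, nsmul_eq_mul]
  have hmin : minActionRegPr F J (J + d) (Nat.le_add_right J d) ε₀ U
      ≤ (Fintype.card (Plaq (F.P (J + d)) 0) : ℝ) * ((1 / 2) * (ε₀ * ((F.L : ℝ)⁻¹) ^ (2 * d)) ^ 2) := by
    by_cases hne : (regFibrePr F J (J + d) (Nat.le_add_right J d) ε₀ U).Nonempty
    · obtain ⟨U', hU'⟩ := hne
      exact (minActionRegPr_le F hU').trans (hA U' hU')
    · have : (fun W => wilsonAction4 W) '' regFibrePr F J (J + d) (Nat.le_add_right J d) ε₀ U = ∅ := by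
        rw [Set.image_eq_empty]; exact Set.not_nonempty_iff_eq_empty.mp hne
      unfold minActionRegPr; rw [this, Real.sInf_empty]; positivity
  calc (F.scheme ℰp γ).β (J + d) * minActionRegPr F J (J + d) (Nat.le_add_right J d) ε₀ U
      ≤ (F.scheme ℰp γ).β (J + d) * ((Fintype.card (Plaq (F.P (J + d)) 0) : ℝ) * ((1 / 2) * (ε₀ * ((F.L : ℝ)⁻¹) ^ (2 * d)) ^ 2)) :=
        mul_le_mul_of_nonneg_left hmin hβ0
    _ = 12 * ε₀ ^ 2 * (F.L : ℝ) ^ (3 * F.m + 4 * J) / γ := by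
        rw [hβ, hplaq]
        have hLd : ((F.L : ℝ)⁻¹) ^ (2 * d) = ((F.L : ℝ) ^ (2 * d))⁻¹ := by rw [inv_pow]
        rw [hLd, inv_pow]
        field_simp
        ring

/-- The same bound for an arbitrary depth `K ≥ J` (and an arbitrary proof of `J ≤ K`). [cite: Balaban1985UV3, (11) p.258] -/
theorem beta_mul_minActionRegPr_le' (F : T3Family) {γ : ℝ} (hγ : 0 < γ) (ε₀ : ℝ) {J K : ℕ} (hJK : J ≤ K)
    (U : GaugeField (F.P J) 0 (Matrix.specialUnitaryGroup (Fin 2) ℂ)) :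
    (F.scheme ℰp γ).β K * minActionRegPr F J K hJK ε₀ U ≤ 12 * ε₀ ^ 2 * (F.L : ℝ) ^ (3 * F.m + 4 * J) / γ := by
  obtain ⟨d, rfl⟩ := Nat.exists_eq_add_of_le hJK
  exact beta_mul_minActionRegPr_le F hγ ε₀ J d U

/-! ## §4 PROVED: the abstract Dini lemma and the Arzelà step -/

/-- A bounded, eventually almost-nondecreasing real sequence (`a n ≤ a n' + e n` for `N ≤ n ≤ n'`, `e → 0`) converges:
`b n := inf_{k ≥ n} a k` is nondecreasing and bounded, and `b n ≤ a n ≤ b n + e n`. [folklore] -/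
theorem exists_tendsto_of_almostMono {a e : ℕ → ℝ} {M : ℝ} {N : ℕ} (h0 : ∀ n, 0 ≤ a n) (hM : ∀ n, a n ≤ M)
    (he : Tendsto e atTop (𝓝 0)) (hmono : ∀ n n', N ≤ n → n ≤ n' → a n ≤ a n' + e n) :
    ∃ l, Tendsto a atTop (𝓝 l) := by
  let b : ℕ → ℝ := fun n => sInf (a '' Set.Ici n)
  have hne : ∀ n, (a '' Set.Ici n).Nonempty := fun n => ⟨a n, n, Set.mem_Ici.mpr le_rfl, rfl⟩
  have hbdd : ∀ n, BddBelow (a '' Set.Ici n) := fun n => ⟨0, by rintro _ ⟨k, _, rfl⟩; exact h0 k⟩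
  have hb_le : ∀ n k, n ≤ k → b n ≤ a k := fun n k hk => csInf_le (hbdd n) ⟨k, hk, rfl⟩
  have hb_mono : Monotone b := fun n n' hnn' =>
    le_csInf (hne n') (by rintro _ ⟨k, hk, rfl⟩; exact hb_le n k (hnn'.trans hk))
  have hb_bdd : BddAbove (Set.range b) := ⟨M, by rintro _ ⟨n, rfl⟩; exact (hb_le n n le_rfl).trans (hM n)⟩
  have hb_tend : Tendsto b atTop (𝓝 (⨆ n, b n)) := tendsto_atTop_ciSup hb_mono hb_bdd
  have hab : ∀ n, N ≤ n → a n ≤ b n + e n := fun n hn => by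
    have : a n - e n ≤ b n := le_csInf (hne n) (by rintro _ ⟨k, hk, rfl⟩; linarith [hmono n k hn hk])
    linarith
  refine ⟨⨆ n, b n, tendsto_of_tendsto_of_tendsto_of_le_of_le' (h := fun n => b n + e n) hb_tend ?_ ?_ ?_⟩
  · simpa using hb_tend.add he
  · exact Eventually.of_forall fun n => hb_le n n le_rfl
  · exact (eventually_ge_atTop N).mono fun n hn => hab n hn

/-- THE ARZELÀ STEP on the compact configuration space `SU(2)^{bonds}`: uniform (in the index, from `N₀` on) equicontinuity on a set `W`
in one-bond `dist1`-closeness upgrades pointwise Cauchy convergence on `W` to uniform Cauchy convergence on `W` (finite `δ/2`-net by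
compactness; net points chosen inside `W`; triangle inequality for `dist1`). [folklore] -/
theorem uniformCauchyOn_of_equicontinuous {P : Params} {j : ℕ}
    (W : Set (GaugeField P j (Matrix.specialUnitaryGroup (Fin 2) ℂ)))
    (f : ℕ → GaugeField P j (Matrix.specialUnitaryGroup (Fin 2) ℂ) → ℝ) (N₀ : ℕ)
    (hE : ∀ η : ℝ, 0 < η → ∃ δ : ℝ, 0 < δ ∧ ∀ K, N₀ ≤ K →
      ∀ U V, U ∈ W → V ∈ W → (∀ b, dist1 ((U b)⁻¹ * V b) < δ) → |f K U - f K V| ≤ η)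
    (hC : ∀ U ∈ W, ∀ η : ℝ, 0 < η → ∃ N, ∀ K K', N ≤ K → K ≤ K' → |f K U - f K' U| ≤ η) :
    ∀ η : ℝ, 0 < η → ∃ N, ∀ K K', N ≤ K → K ≤ K' → ∀ U ∈ W, |f K U - f K' U| ≤ η := by
  classical
  haveI : CompactSpace (GaugeField P j (Matrix.specialUnitaryGroup (Fin 2) ℂ)) :=
    inferInstanceAs (CompactSpace (PBond P j → Matrix.specialUnitaryGroup (Fin 2) ℂ))
  intro η hη
  obtain ⟨δ, hδ, hEδ⟩ := hE (η / 3) (by positivity)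
  -- the open `δ/2`-cells
  let O : GaugeField P j (Matrix.specialUnitaryGroup (Fin 2) ℂ) → Set (GaugeField P j (Matrix.specialUnitaryGroup (Fin 2) ℂ)) :=
    fun V => {U | ∀ b, dist1 ((V b)⁻¹ * U b) < δ / 2}
  have hO : ∀ V, IsOpen (O V) := by
    intro V
    have h : O V = ⋂ b : PBond P j, {U | dist1 ((V b)⁻¹ * U b) < δ / 2} := by
      ext U; simp only [O, Set.mem_iInter, Set.mem_setOf_eq]
    rw [h]
    exact isOpen_iInter_of_finite fun b =>
      isOpen_lt ((B12ContinuousTransportInvarianceOn.continuous_dist1_SU (N := 2)).comp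
        (continuous_const.mul (continuous_apply b))) continuous_const
  have hcover : (Set.univ : Set (GaugeField P j (Matrix.specialUnitaryGroup (Fin 2) ℂ))) ⊆ ⋃ V, O V := by
    intro U _
    refine Set.mem_iUnion.mpr ⟨U, fun b => ?_⟩
    rw [inv_mul_cancel, GaugeGroup.dist1_one]; positivity
  obtain ⟨t, ht⟩ := isCompact_univ.elim_finite_subcover O hO hcover
  -- net points inside `W` and their Cauchy thresholds
  let pick : GaugeField P j (Matrix.specialUnitaryGroup (Fin 2) ℂ) → GaugeField P j (Matrix.specialUnitaryGroup (Fin 2) ℂ) :=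
    fun V => if h : (W ∩ O V).Nonempty then h.some else V
  have hpick : ∀ V, (W ∩ O V).Nonempty → pick V ∈ W ∩ O V := by
    intro V h; simp only [pick, dif_pos h]; exact h.some_mem
  have hN : ∀ V, ∃ N, (W ∩ O V).Nonempty → ∀ K K', N ≤ K → K ≤ K' → |f K (pick V) - f K' (pick V)| ≤ η / 3 := by
    intro V
    by_cases h : (W ∩ O V).Nonempty
    · obtain ⟨N, hN⟩ := hC (pick V) (hpick V h).1 (η / 3) (by positivity)
      exact ⟨N, fun _ => hN⟩
    · exact ⟨0, fun h' => absurd h' h⟩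
  choose Nf hNf using hN
  refine ⟨max N₀ (t.sup Nf), fun K K' hK hKK' U hU => ?_⟩
  have hK₀ : N₀ ≤ K := (le_max_left _ _).trans hK
  obtain ⟨V, hVt, hUV⟩ : ∃ V ∈ t, U ∈ O V := by
    have := ht (Set.mem_univ U)
    simpa only [Set.mem_iUnion, exists_prop] using this
  have hne : (W ∩ O V).Nonempty := ⟨U, hU, hUV⟩
  obtain ⟨hwW, hwO⟩ := hpick V hne
  -- closeness of `U` and the net point `w := pick V`
  have hclose : ∀ b, dist1 ((U b)⁻¹ * (pick V) b) < δ := by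
    intro b
    have h1 : dist1 ((U b)⁻¹ * V b) < δ / 2 := by
      have : (U b)⁻¹ * V b = ((V b)⁻¹ * U b)⁻¹ := by rw [mul_inv_rev, inv_inv]
      rw [this, GaugeGroup.dist1_inv]; exact hUV b
    have h2 : dist1 ((V b)⁻¹ * (pick V) b) < δ / 2 := hwO b
    have h3 : (U b)⁻¹ * (pick V) b = ((U b)⁻¹ * V b) * ((V b)⁻¹ * (pick V) b) := by group
    rw [h3]
    linarith [GaugeGroup.dist1_mul_le ((U b)⁻¹ * V b) ((V b)⁻¹ * (pick V) b)]
  have hNK : Nf V ≤ K := ((Finset.le_sup hVt).trans (le_max_right _ _)).trans hK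
  have e1 : |f K U - f K (pick V)| ≤ η / 3 := hEδ K hK₀ U (pick V) hU hwW hclose
  have e2 : |f K (pick V) - f K' (pick V)| ≤ η / 3 := hNf V hne K K' hNK hKK'
  have e3 : |f K' U - f K' (pick V)| ≤ η / 3 := hEδ K' (hK₀.trans hKK') U (pick V) hU hwW hclose
  calc |f K U - f K' U|
      = |(f K U - f K (pick V)) + (f K (pick V) - f K' (pick V)) - (f K' U - f K' (pick V))| := by ring_nf
    _ ≤ |f K U - f K (pick V)| + |f K (pick V) - f K' (pick V)| + |f K' U - f K' (pick V)| := abs_sub_le_of_le_of_le' _ _ _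
    _ ≤ η / 3 + η / 3 + η / 3 := by linarith
    _ = η := by ring
where
  /-- `|x + y − z| ≤ |x| + |y| + |z|`. -/
  abs_sub_le_of_le_of_le' (x y z : ℝ) : |x + y - z| ≤ |x| + |y| + |z| := by
    calc |x + y - z| ≤ |x + y| + |z| := abs_sub _ _
      _ ≤ |x| + |y| + |z| := by linarith [abs_add_le x y]

/-! ## §5 PROVED: the glue `M → E → S2α′` -/

/-- **THE DINI TABLE.**  One-sided Jensen monotonicity in the depth (M) + depth-uniform equicontinuity on the window (E) ⇒ S2α′.
Proof: the a-priori bound makes `K ↦ f_K(U)` bounded; with M it converges for every window datum (Dini lemma); with E and the compactness of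
`SU(2)^{bonds}` the convergence is uniform on the window (Arzelà step); `A_J(n) := 4 · sup {|f_K U − f_{K'} U| : U ∈ window, J ≤ K ≤ K',
n ≤ K − J}` is then a null profile bounding the 4-point discrepancy (depth `0` is covered by the bound `4M_J`). -/
theorem classicalPerHeight_of_monotone_equicontinuous (hM : DepthMonotoneRegPr) (hE : DepthEquicontinuousRegPr) :
    ClassicalPerHeight := by
  classical
  intro L b₀ p₀ hb hp
  obtain ⟨ε₁, hε₁, HM⟩ := hM L b₀ p₀ hb hp
  obtain ⟨ε₂, hε₂, HE⟩ := hE L b₀ p₀ hb hp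
  refine ⟨min ε₁ ε₂, lt_min hε₁ hε₂, fun ε₀ hε₀ hε₀le => ?_⟩
  obtain ⟨γ₁, hγ₁, HM⟩ := HM ε₀ hε₀ (hε₀le.trans (min_le_left _ _))
  obtain ⟨γ₂, hγ₂, HE⟩ := HE ε₀ hε₀ (hε₀le.trans (min_le_right _ _))
  refine ⟨min γ₁ γ₂, lt_min hγ₁ hγ₂, fun F γ hFL hγ hγle J => ?_⟩
  obtain ⟨e, he0, he, HM⟩ := HM F γ hFL hγ (hγle.trans (min_le_left _ _)) J
  have HE := HE F γ hFL hγ (hγle.trans (min_le_right _ _)) J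
  -- the family `f K U := β_K · minActionRegPr F J K U` (`0` below height `J`) and the window `Wn`
  let f : ℕ → GaugeField (F.P J) 0 (Matrix.specialUnitaryGroup (Fin 2) ℂ) → ℝ := fun K U =>
    if h : J ≤ K then (F.scheme ℰp γ).β K * minActionRegPr F J K h ε₀ U else 0
  have hf : ∀ (K : ℕ) (h : J ≤ K) (U : GaugeField (F.P J) 0 (Matrix.specialUnitaryGroup (Fin 2) ℂ)),
      f K U = (F.scheme ℰp γ).β K * minActionRegPr F J K h ε₀ U := by
    intro K h U; simp only [f, dif_pos h]
  let Wn : Set (GaugeField (F.P J) 0 (Matrix.specialUnitaryGroup (Fin 2) ℂ)) := {U | PlaqSmall (θBal F.L γ b₀ p₀ J) U}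
  have hL0 : (0 : ℝ) < F.L := by exact_mod_cast Nat.lt_of_lt_of_le Nat.zero_lt_one F.hL.2.le
  obtain ⟨M, hM0, hfM'⟩ : ∃ M : ℝ, 0 ≤ M ∧ ∀ (K : ℕ) (h : J ≤ K) (U : GaugeField (F.P J) 0 (Matrix.specialUnitaryGroup (Fin 2) ℂ)),
      (F.scheme ℰp γ).β K * minActionRegPr F J K h ε₀ U ≤ M :=
    ⟨12 * ε₀ ^ 2 * (F.L : ℝ) ^ (3 * F.m + 4 * J) / γ, by positivity, fun K h U => beta_mul_minActionRegPr_le' F hγ ε₀ h U⟩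
  have hf0 : ∀ K U, 0 ≤ f K U := by
    intro K U
    by_cases h : J ≤ K
    · rw [hf K h U]; exact mul_nonneg (F.scheme_β_nonneg ℰp hγ.le K) (minActionRegPr_nonneg F U)
    · simp only [f, dif_neg h]; exact le_rfl
  have hfM : ∀ K U, f K U ≤ M := by
    intro K U
    by_cases h : J ≤ K
    · rw [hf K h U]; exact hfM' K h U
    · simp only [f, dif_neg h]; exact hM0
  have hfd : ∀ K K' U, |f K U - f K' U| ≤ M := by
    intro K K' U
    rw [abs_sub_le_iff]; constructor <;> linarith [hf0 K U, hf0 K' U, hfM K U, hfM K' U]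
  -- Step 1 (Dini): pointwise convergence on the window
  have hconv : ∀ U ∈ Wn, ∃ l, Tendsto (fun K => f K U) atTop (𝓝 l) := by
    intro U hU
    refine exists_tendsto_of_almostMono (e := fun K => e (K - J)) (N := J + 1) (fun K => hf0 K U) (fun K => hfM K U)
      (he.comp (tendsto_sub_atTop_nat J)) ?_
    intro K K' hK hKK'
    have hJK : J < K := Nat.lt_of_lt_of_le (Nat.lt_succ_self J) hK
    have hJK' : J < K' := lt_of_lt_of_le hJK hKK'
    rw [hf K hJK.le U, hf K' hJK'.le U]
    exact HM K K' hJK hJK' hKK' U hU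
  -- Step 2: pointwise Cauchy thresholds
  have hC : ∀ U ∈ Wn, ∀ η : ℝ, 0 < η → ∃ N, ∀ K K', N ≤ K → K ≤ K' → |f K U - f K' U| ≤ η := by
    intro U hU η hη
    obtain ⟨l, hl⟩ := hconv U hU
    obtain ⟨N, hN⟩ := Metric.tendsto_atTop.mp hl (η / 2) (by positivity)
    refine ⟨N, fun K K' hK hKK' => ?_⟩
    have h1 := hN K hK
    have h2 := hN K' (hK.trans hKK')
    rw [Real.dist_eq] at h1 h2
    rw [abs_sub_lt_iff] at h1 h2
    rw [abs_sub_le_iff]; constructor <;> linarith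
  -- Step 3 (Arzelà): uniform Cauchy on the window
  have hEW : ∀ η : ℝ, 0 < η → ∃ δ : ℝ, 0 < δ ∧ ∀ K, J + 1 ≤ K →
      ∀ U V, U ∈ Wn → V ∈ Wn → (∀ b, dist1 ((U b)⁻¹ * V b) < δ) → |f K U - f K V| ≤ η := by
    intro η hη
    obtain ⟨δ, hδ, H⟩ := HE η hη
    refine ⟨δ, hδ, fun K hK U V hU hV hUV => ?_⟩
    have hJK : J < K := Nat.lt_of_lt_of_le (Nat.lt_succ_self J) hK
    rw [hf K hJK.le U, hf K hJK.le V]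
    exact H K hJK U V hU hV hUV
  have hunif := uniformCauchyOn_of_equicontinuous Wn f (J + 1) hEW hC
  -- Step 4: the null profile
  let S : ℕ → Set ℝ := fun n =>
    insert 0 {x | ∃ (K K' : ℕ) (U : GaugeField (F.P J) 0 (Matrix.specialUnitaryGroup (Fin 2) ℂ)),
      J ≤ K ∧ K ≤ K' ∧ n ≤ K - J ∧ U ∈ Wn ∧ x = |f K U - f K' U|}
  have hSne : ∀ n, (S n).Nonempty := fun n => ⟨0, Set.mem_insert _ _⟩
  have hSbdd : ∀ n, BddAbove (S n) := by
    intro n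
    refine ⟨M, fun x hx => ?_⟩
    rcases Set.mem_insert_iff.mp hx with rfl | ⟨K, K', U, -, -, -, -, rfl⟩
    · exact hM0
    · exact hfd K K' U
  have hS0 : ∀ n, 0 ≤ sSup (S n) := fun n => le_csSup (hSbdd n) (Set.mem_insert _ _)
  refine ⟨fun n => 4 * sSup (S n), fun n => mul_nonneg (by norm_num) (hS0 n), ?_, ?_⟩
  · -- `A → 0`
    rw [Metric.tendsto_atTop]
    intro η hη
    obtain ⟨N, hN⟩ := hunif (η / 8) (by positivity)
    refine ⟨N, fun n hn => ?_⟩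
    have hsup : sSup (S n) ≤ η / 8 := by
      refine csSup_le (hSne n) fun x hx => ?_
      rcases Set.mem_insert_iff.mp hx with rfl | ⟨K, K', U, hJK, hKK', hnK, hU, rfl⟩
      · positivity
      · exact hN K K' (hn.trans (hnK.trans (Nat.sub_le K J))) hKK' U hU
    rw [Real.dist_eq, sub_zero, abs_of_nonneg (mul_nonneg (by norm_num) (hS0 n))]
    linarith [hS0 n]
  · -- the 4-point bound
    intro K K' hJK hJK' hKK' b b' U V W Z hU hV hW hZ _ _ _ _
    have key : ∀ X ∈ Wn, |f K X - f K' X| ≤ sSup (S (K - J)) := fun X hX =>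
      le_csSup (hSbdd _) (Set.mem_insert_of_mem _ ⟨K, K', X, hJK, hKK', le_rfl, hX, rfl⟩)
    have eU := key U hU
    have eV := key V hV
    have eW := key W hW
    have eZ := key Z hZ
    rw [hf K hJK U, hf K' hJK' U] at eU
    rw [hf K hJK V, hf K' hJK' V] at eV
    rw [hf K hJK W, hf K' hJK' W] at eW
    rw [hf K hJK Z, hf K' hJK' Z] at eZ
    set aU := (F.scheme ℰp γ).β K * minActionRegPr F J K hJK ε₀ U - (F.scheme ℰp γ).β K' * minActionRegPr F J K' hJK' ε₀ U
    set aV := (F.scheme ℰp γ).β K * minActionRegPr F J K hJK ε₀ V - (F.scheme ℰp γ).β K' * minActionRegPr F J K' hJK' ε₀ V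
    set aW := (F.scheme ℰp γ).β K * minActionRegPr F J K hJK ε₀ W - (F.scheme ℰp γ).β K' * minActionRegPr F J K' hJK' ε₀ W
    set aZ := (F.scheme ℰp γ).β K * minActionRegPr F J K hJK ε₀ Z - (F.scheme ℰp γ).β K' * minActionRegPr F J K' hJK' ε₀ Z
    calc |aU - aV - (aW - aZ)| ≤ |aU - aV| + |aW - aZ| := abs_sub _ _
      _ ≤ (|aU| + |aV|) + (|aW| + |aZ|) := add_le_add (abs_sub _ _) (abs_sub _ _)
      _ ≤ 4 * sSup (S (K - J)) := by linarith


/-! ## §6 PROVED (v2): one-step monotonicity telescopes to M -/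

/-- M₁ ⇒ M with `e_J(n) := Σ_{m ≥ n} d_J(m)` (tails of a summable nonnegative series are nonnegative and null; telescoping). -/
theorem depthMonotone_of_step (h : DepthMonotoneStep) : DepthMonotoneRegPr := by
  intro L b₀ p₀ hb hp
  obtain ⟨ε₁, hε₁, H⟩ := h L b₀ p₀ hb hp
  refine ⟨ε₁, hε₁, fun ε₀ hε₀ hε₀le => ?_⟩
  obtain ⟨γ₁, hγ₁, H⟩ := H ε₀ hε₀ hε₀le
  refine ⟨γ₁, hγ₁, fun F γ hFL hγ hγle J => ?_⟩
  obtain ⟨d, hd0, hds, H⟩ := H F γ hFL hγ hγle J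
  refine ⟨fun n => ∑' m, d (m + n), fun n => tsum_nonneg fun m => hd0 _, tendsto_sum_nat_add d, ?_⟩
  intro K K' hJK hJK' hKK' U hU
  -- telescoping: `f K ≤ f (K + i) + Σ_{m < i} d (K - J + m)` by induction on `i`
  have step : ∀ i : ℕ, (F.scheme ℰp γ).β K * minActionRegPr F J K hJK.le ε₀ U
      ≤ (F.scheme ℰp γ).β (K + i) * minActionRegPr F J (K + i) (hJK.le.trans (Nat.le_add_right K i)) ε₀ U
        + ∑ m ∈ Finset.range i, d (K - J + m) := by
    intro i
    induction i with
    | zero => simp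
    | succ i ih =>
      have hJKi : J < K + i := Nat.lt_of_lt_of_le hJK (Nat.le_add_right K i)
      have h1 := H (K + i) hJKi U hU
      have hsub : K + i - J = K - J + i := by omega
      rw [hsub] at h1
      rw [Finset.sum_range_succ]
      have : (F.scheme ℰp γ).β (K + i + 1) * minActionRegPr F J (K + i + 1) (Nat.le_succ_of_le hJKi.le) ε₀ U
          = (F.scheme ℰp γ).β (K + (i + 1)) * minActionRegPr F J (K + (i + 1)) (hJK.le.trans (Nat.le_add_right K (i + 1))) ε₀ U := rfl
      linarith
  obtain ⟨i, rfl⟩ := Nat.exists_eq_add_of_le hKK'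
  have htail : ∑ m ∈ Finset.range i, d (K - J + m) ≤ ∑' m, d (m + (K - J)) := by
    have hs : Summable fun m => d (m + (K - J)) := (summable_nat_add_iff (K - J)).mpr hds
    calc ∑ m ∈ Finset.range i, d (K - J + m) = ∑ m ∈ Finset.range i, d (m + (K - J)) := by
          refine Finset.sum_congr rfl fun m _ => by rw [Nat.add_comm]
      _ ≤ ∑' m, d (m + (K - J)) := hs.sum_le_tsum (Finset.range i) fun m _ => hd0 _
  have e := step i
  have : (F.scheme ℰp γ).β (K + i) * minActionRegPr F J (K + i) (hJK.le.trans (Nat.le_add_right K i)) ε₀ U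
      = (F.scheme ℰp γ).β (K + i) * minActionRegPr F J (K + i) hJK'.le ε₀ U := rfl
  linarith

/-! ## §7 PROVED (v2, LINE g16-2): the competitor-surgery table gives E -/

/-- E-N + E-I + E-S ⇒ E: `f_K(V) = β_K inf_{ε₀}(V) ≤ β_K A(v) ≤ β_K A(u) + η/2 ≤ β_K inf_{ε₀/2}(U) + η = f_K(U) + η` for a near-minimal
half-radius `u` (nonempty fibre, interior infimum) and its surgery `v`; symmetric in `U, V` (`dist1` is inversion-invariant). -/
theorem depthEquicontinuous_of_surgery (hN : RegFibreHalfNonempty) (hI : InteriorInfimum) (hS : CompetitorSurgery) :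
    DepthEquicontinuousRegPr := by
  classical
  intro L b₀ p₀ hb hp
  obtain ⟨ε₁, hε₁, HN⟩ := hN L b₀ p₀ hb hp
  obtain ⟨ε₂, hε₂, HI⟩ := hI L b₀ p₀ hb hp
  obtain ⟨ε₃, hε₃, HS⟩ := hS L b₀ p₀ hb hp
  refine ⟨min ε₁ (min ε₂ ε₃), lt_min hε₁ (lt_min hε₂ hε₃), fun ε₀ hε₀ hε₀le => ?_⟩
  obtain ⟨γ₁, hγ₁, HN⟩ := HN ε₀ hε₀ (hε₀le.trans (min_le_left _ _))
  obtain ⟨γ₂, hγ₂, HI⟩ := HI ε₀ hε₀ (hε₀le.trans ((min_le_right _ _).trans (min_le_left _ _)))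
  obtain ⟨γ₃, hγ₃, HS⟩ := HS ε₀ hε₀ (hε₀le.trans ((min_le_right _ _).trans (min_le_right _ _)))
  refine ⟨min γ₁ (min γ₂ γ₃), lt_min hγ₁ (lt_min hγ₂ hγ₃), fun F γ hFL hγ hγle J η hη => ?_⟩
  have HN := HN F γ hFL hγ (hγle.trans (min_le_left _ _))
  have HI := HI F γ hFL hγ (hγle.trans ((min_le_right _ _).trans (min_le_left _ _)))
  obtain ⟨δ, hδ, HS⟩ := HS F γ hFL hγ (hγle.trans ((min_le_right _ _).trans (min_le_right _ _))) J (η / 2) (by positivity)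
  refine ⟨δ, hδ, fun K hJK U V hU hV hUV => ?_⟩
  have hβ0 : 0 ≤ (F.scheme ℰp γ).β K := F.scheme_β_nonneg ℰp hγ.le K
  -- one direction, for any ordered pair of close window data
  have one : ∀ (U V : GaugeField (F.P J) 0 (Matrix.specialUnitaryGroup (Fin 2) ℂ)),
      PlaqSmall (θBal F.L γ b₀ p₀ J) U → PlaqSmall (θBal F.L γ b₀ p₀ J) V → (∀ b, dist1 ((U b)⁻¹ * V b) < δ) →
      (F.scheme ℰp γ).β K * minActionRegPr F J K hJK.le ε₀ V ≤ (F.scheme ℰp γ).β K * minActionRegPr F J K hJK.le ε₀ U + η := by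
    intro U V hU hV hUV
    have hne := HN J K hJK U hU
    rw [HI J K hJK U hU]
    -- near-minimal half-radius competitor for `U`
    by_contra hcon
    rw [not_le] at hcon
    have hβpos : 0 < (F.scheme ℰp γ).β K := by
      rcases hβ0.lt_or_eq with h | h
      · exact h
      · exfalso
        rw [← h, zero_mul, zero_mul, zero_add] at hcon
        exact (lt_irrefl _ (hη.trans hcon))
    have hlt : sInf ((fun W => wilsonAction4 W) '' regFibrePr F J K hJK.le (ε₀ / 2) U)
        < minActionRegPr F J K hJK.le (ε₀ / 2) U + η / 2 / (F.scheme ℰp γ).β K := by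
      show minActionRegPr F J K hJK.le (ε₀ / 2) U < _
      have : 0 < η / 2 / (F.scheme ℰp γ).β K := by positivity
      linarith
    obtain ⟨_, ⟨u, hu, rfl⟩, hua⟩ := exists_lt_of_csInf_lt (hne.image _) hlt
    obtain ⟨v, hv, hvu⟩ := HS K hJK U V hU hV hUV u hu
    have hmv : minActionRegPr F J K hJK.le ε₀ V ≤ wilsonAction4 v := minActionRegPr_le F hv
    have h1 : (F.scheme ℰp γ).β K * minActionRegPr F J K hJK.le ε₀ V ≤ (F.scheme ℰp γ).β K * wilsonAction4 u + η / 2 :=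
      (mul_le_mul_of_nonneg_left hmv hβ0).trans hvu
    have h2 : (F.scheme ℰp γ).β K * wilsonAction4 u
        < (F.scheme ℰp γ).β K * minActionRegPr F J K hJK.le (ε₀ / 2) U + η / 2 := by
      have := mul_lt_mul_of_pos_left hua hβpos
      rwa [mul_add, mul_div_cancel₀ _ hβpos.ne'] at this
    linarith
  have hVU : ∀ b, dist1 ((V b)⁻¹ * U b) < δ := fun b => by
    have : (V b)⁻¹ * U b = ((U b)⁻¹ * V b)⁻¹ := by rw [mul_inv_rev, inv_inv]
    rw [this, GaugeGroup.dist1_inv]; exact hUV b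
  rw [abs_sub_le_iff]
  constructor
  · linarith [one V U hV hU hVU]
  · linarith [one U V hU hV hUV]

/-! ## §7b (v3) E-N and E-I from the printed-minimiser package P (tree schemas BY NAME) -/

/-- The half-radius fibre sits inside the full-radius one (`0 ≤ ε₀`; named for provers, idea-crit-5 #238 E11). -/
theorem regFibrePr_half_subset (F : T3Family) {J K : ℕ} (hJK : J ≤ K) {ε₀ : ℝ} (hε₀ : 0 ≤ ε₀)
    (U : GaugeField (F.P J) 0 (Matrix.specialUnitaryGroup (Fin 2) ℂ)) :
    regFibrePr F J K hJK (ε₀ / 2) U ⊆ regFibrePr F J K hJK ε₀ U :=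
  T3PrintedMinimiserExistence.regFibrePr_mono F (by linarith) U

/-- THRESHOLDS for §7b: for `γ ≤ γ₁ (≤ 1)`, at EVERY height `0 < θ_i ≤ a₁` and `B₃θ_i ≤ ε₀/2` (`T3ThresholdSmallness.exists_forall_θBal_le`). -/
theorem exists_gamma_thresholds {L : ℕ} (hL : 1 ≤ L) {b₀ : ℝ} (hb₀ : 0 < b₀) (p₀ : ℝ) {a₁ B₃ ε₀ : ℝ} (ha₁ : 0 < a₁)
    (hB₃ : 0 < B₃) (hε₀ : 0 < ε₀) :
    ∃ γ₁ : ℝ, 0 < γ₁ ∧ ∀ γ : ℝ, 0 < γ → γ ≤ γ₁ → ∀ i : ℕ,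
      0 < θBal L γ b₀ p₀ i ∧ θBal L γ b₀ p₀ i ≤ a₁ ∧ B₃ * θBal L γ b₀ p₀ i ≤ ε₀ / 2 := by
  obtain ⟨γ₁, hγ₁, hθ⟩ :=
    T3ThresholdSmallness.exists_forall_θBal_le hL b₀ p₀ (lt_min ha₁ (div_pos (half_pos hε₀) hB₃))
  refine ⟨min γ₁ 1, lt_min hγ₁ one_pos, fun γ hγ hγle i => ?_⟩
  have h := hθ γ hγ (hγle.trans (min_le_left _ _)) i
  refine ⟨T3MinimiserStabilityReduction.θBal_pos hL hγ (hγle.trans (min_le_right _ _)) hb₀ p₀ i,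
    h.trans (min_le_left _ _), ?_⟩
  calc B₃ * θBal L γ b₀ p₀ i ≤ B₃ * (ε₀ / 2 / B₃) := by gcongr; exact h.trans (min_le_right _ _)
    _ = ε₀ / 2 := by field_simp

/-- **E-N ⇐ P**: Thm 1's minimiser over (8) at radius `B₃θ_J ≤ ε₀/2` lies in the half-radius fibre. -/
theorem regFibreHalfNonempty_of_package (hP : PrintedMinimiserPackage) : RegFibreHalfNonempty := by
  intro L b₀ p₀ hb₀ _hp₀
  obtain ⟨a₀, a₁, B₃, ha₀, ha₁, hB₃, h8, -⟩ := hP L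
  refine ⟨a₀, ha₀, fun ε₀ hε₀ _hε₀a => ?_⟩
  rcases Nat.lt_or_ge L 1 with hL | hL
  · exact ⟨1, one_pos, fun F γ hF _ _ J K hJK U _ => absurd F.hL.2 (by omega)⟩
  obtain ⟨γ₁, hγ₁, hθ⟩ := exists_gamma_thresholds hL hb₀ p₀ ha₁ hB₃ hε₀
  refine ⟨γ₁, hγ₁, fun F γ hF hγ hγle J K hJK U hU => ?_⟩
  obtain ⟨hθpos, hθa, hθB⟩ := hθ γ hγ hγle J
  rw [← hF] at hθpos hθa hθB
  obtain ⟨u, hu8, -⟩ := h8 F hF J K hJK _ hθpos hθa U hU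
  exact ⟨u, T3PrintedMinimiserExistence.regFibrePr_mono F hθB U hu8⟩

/-- **E-I ⇐ P**: the same minimiser realises BOTH infima (G-K1aR-2 at radius `ε₀` and at radius `ε₀/2`, both in `[B₃θ_J, a₀]`). -/
theorem interiorInfimum_of_package (hP : PrintedMinimiserPackage) : InteriorInfimum := by
  intro L b₀ p₀ hb₀ _hp₀
  obtain ⟨a₀, a₁, B₃, ha₀, ha₁, hB₃, h8, h68⟩ := hP L
  refine ⟨a₀, ha₀, fun ε₀ hε₀ hε₀a => ?_⟩
  rcases Nat.lt_or_ge L 1 with hL | hL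
  · exact ⟨1, one_pos, fun F γ hF _ _ J K hJK U _ => absurd F.hL.2 (by omega)⟩
  obtain ⟨γ₁, hγ₁, hθ⟩ := exists_gamma_thresholds hL hb₀ p₀ ha₁ hB₃ hε₀
  refine ⟨γ₁, hγ₁, fun F γ hF hγ hγle J K hJK U hU => ?_⟩
  obtain ⟨hθpos, hθa, hθB⟩ := hθ γ hγ hγle J
  rw [← hF] at hθpos hθa hθB
  obtain ⟨u, hu8, hmin8⟩ := h8 F hF J K hJK _ hθpos hθa U hU
  have hBε : B₃ * θBal F.L γ b₀ p₀ J ≤ ε₀ := hθB.trans (by linarith)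
  have hfull := h68 F hF J K hJK _ ε₀ hθpos hθa hBε hε₀a U hU u hu8 hmin8
  have hhalf := h68 F hF J K hJK _ (ε₀ / 2) hθpos hθa hθB (by linarith) U hU u hu8 hmin8
  rw [← T3PrintedMinimiserExistence.minActionRegPr_eq_of_isMinOn F
      (T3PrintedMinimiserExistence.regFibrePr_mono F hBε U hu8) hfull,
    ← T3PrintedMinimiserExistence.minActionRegPr_eq_of_isMinOn F
      (T3PrintedMinimiserExistence.regFibrePr_mono F hθB U hu8) hhalf]

/-- **P ⇐ P⁺** (projection). -/
theorem printedMinimiserPackage_of_averaging (hA : AveragingPackage) : PrintedMinimiserPackage := fun L => by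
  obtain ⟨a₀, a₁, B₃, C₀, c₂', ha₀, ha₁, hB₃, -, -, h8, h68, -, -⟩ := hA L
  exact ⟨a₀, a₁, B₃, ha₀, ha₁, hB₃, h8, h68⟩

/-- P, DERIVED (v4). -/
theorem stub_printedMinimiserPackage : PrintedMinimiserPackage :=
  printedMinimiserPackage_of_averaging stub_averagingPackage

/-- E-N, DERIVED (v3). -/
theorem stub_regFibreHalfNonempty : RegFibreHalfNonempty :=
  regFibreHalfNonempty_of_package stub_printedMinimiserPackage

/-- E-I, DERIVED (v3). -/
theorem stub_interiorInfimum : InteriorInfimum :=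
  interiorInfimum_of_package stub_printedMinimiserPackage

/-! ## §7d (v5) D DERIVED from the per-configuration contraction D′: fixed-height power counting, PROVED -/

/-- **Fixed-height power counting** (PROVED): with `x = 1/L`, `β_K = L^K/γ` and the (8)-radius `a = B₃θ·x^{2(K+1−J)}` at depth `K + 1`,
`β_K·C₂a³·L^{3(m+K)} ≤ C₂B₃³θ³γ⁻¹L^{3m+4J}·(x²)^{K−J}` — the cubic defect is GEOMETRIC IN THE DEPTH at fixed datum height (`L^{4n}x^{6n+6} =
x^{2n+6} ≤ x^{2n}`; no `m ≥ 3` condition, unlike the moving-height version `T3UpperLiftSplit.beta_mul_defect_le`). -/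
theorem beta_mul_cubic_le (F : T3Family) {γ : ℝ} (hγ : 0 < γ) {C₂ B₃ θ : ℝ} (hC₂ : 0 ≤ C₂) (hB₃ : 0 ≤ B₃) (hθ : 0 ≤ θ)
    {J K : ℕ} (hJK : J ≤ K) :
    (F.scheme ℰp γ).β K * (C₂ * (B₃ * θ * ((F.L : ℝ)⁻¹) ^ (2 * (K + 1 - J))) ^ 3 * (F.L : ℝ) ^ (3 * (F.m + K))) ≤
      C₂ * B₃ ^ 3 * θ ^ 3 * γ⁻¹ * (F.L : ℝ) ^ (3 * F.m + 4 * J) * (((F.L : ℝ)⁻¹) ^ 2) ^ (K - J) := by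
  obtain ⟨n, rfl⟩ := Nat.exists_eq_add_of_le hJK
  have hL : (0 : ℝ) < F.L := by exact_mod_cast lt_trans zero_lt_one F.hL.2
  set x : ℝ := (F.L : ℝ)⁻¹ with hx_def
  have hx : 0 < x := inv_pos.mpr hL
  have hx1 : x ≤ 1 := inv_le_one_of_one_le₀ (by exact_mod_cast F.hL.2.le)
  have hLx : (F.L : ℝ) * x = 1 := mul_inv_cancel₀ hL.ne'
  have hβ : (F.scheme ℰp γ).β (J + n) = (γ * x ^ (J + n))⁻¹ := rfl
  have e0 : J + n + 1 - J = n + 1 := by omega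
  have e0' : J + n - J = n := by omega
  rw [hβ, e0, e0']
  have e1 : (γ * x ^ (J + n))⁻¹ = γ⁻¹ * (F.L : ℝ) ^ (J + n) := by
    rw [mul_inv, ← inv_pow, hx_def, inv_inv]
  have e2 : (B₃ * θ * x ^ (2 * (n + 1))) ^ 3 = B₃ ^ 3 * θ ^ 3 * x ^ (6 * (n + 1)) := by
    rw [mul_pow, mul_pow, ← pow_mul]
    congr 1
    ring_nf
  have key : (F.L : ℝ) ^ (J + n) * (F.L : ℝ) ^ (3 * (F.m + (J + n))) * x ^ (6 * (n + 1)) ≤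
      (F.L : ℝ) ^ (3 * F.m + 4 * J) * (x ^ 2) ^ n := by
    have h1 : (F.L : ℝ) ^ (J + n) * (F.L : ℝ) ^ (3 * (F.m + (J + n))) * x ^ (6 * (n + 1)) =
        (F.L : ℝ) ^ (3 * F.m + 4 * J) * ((F.L : ℝ) * x) ^ (4 * n) * (x ^ 2) ^ n * x ^ 6 := by
      rw [mul_pow]; ring
    rw [h1, hLx, one_pow, mul_one]
    calc (F.L : ℝ) ^ (3 * F.m + 4 * J) * (x ^ 2) ^ n * x ^ 6
        ≤ (F.L : ℝ) ^ (3 * F.m + 4 * J) * (x ^ 2) ^ n * 1 :=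
          mul_le_mul_of_nonneg_left (pow_le_one₀ hx.le hx1) (by positivity)
      _ = (F.L : ℝ) ^ (3 * F.m + 4 * J) * (x ^ 2) ^ n := mul_one _
  calc (γ * x ^ (J + n))⁻¹ * (C₂ * (B₃ * θ * x ^ (2 * (n + 1))) ^ 3 * (F.L : ℝ) ^ (3 * (F.m + (J + n))))
      = C₂ * B₃ ^ 3 * θ ^ 3 * γ⁻¹ * ((F.L : ℝ) ^ (J + n) * (F.L : ℝ) ^ (3 * (F.m + (J + n))) * x ^ (6 * (n + 1))) := by
        rw [e1, e2]; ring
    _ ≤ C₂ * B₃ ^ 3 * θ ^ 3 * γ⁻¹ * ((F.L : ℝ) ^ (3 * F.m + 4 * J) * (x ^ 2) ^ n) :=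
        mul_le_mul_of_nonneg_left key (by positivity)
    _ = C₂ * B₃ ^ 3 * θ ^ 3 * γ⁻¹ * (F.L : ℝ) ^ (3 * F.m + 4 * J) * (x ^ 2) ^ n := by ring

open Literature.MathematicalPhysics.QuantumFieldTheory.Balaban1983to89.T3TiltDescent in
/-- **D ⇐ D′** (PROVED): at fixed datum height the per-configuration contraction, applied to a configuration in (8) at depth `K+1` (plaquettes
`< B₃θ_J·L^{−2(K+1−J)}`), weighted by `β_K` and rewritten with `β_{K+1} = Lβ_K`, is the depth action inequality with the GEOMETRIC profile
`d_J(n) = C₂B₃³θ_J³γ⁻¹L^{3m+4J}·L^{−2n}`; thresholds `B₃θ_J ≤ c` by `exists_forall_θBal_le`.  (The minimising hypothesis of D is not even used.) -/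
theorem depthActionIneq_of_contraction (hC : ContractionPackage) : DepthActionIneq := by
  intro L b₀ p₀ B₃ hb₀ hp₀ hB₃
  obtain ⟨C₂, c, hC₂, hc, hcon⟩ := hC L
  refine ⟨1, one_pos, fun ε₀ hε₀ _ => ?_⟩
  rcases Nat.lt_or_ge L 1 with hL | hL
  · exact ⟨1, one_pos, fun F γ hF _ _ J => absurd F.hL.2 (by omega)⟩
  obtain ⟨γ₁, hγ₁, hθ⟩ := T3ThresholdSmallness.exists_forall_θBal_le hL b₀ p₀ (show 0 < c / B₃ by positivity)
  refine ⟨min γ₁ 1, lt_min hγ₁ one_pos, fun F γ hF hγ hγle J => ?_⟩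
  have hγ₁' : γ ≤ γ₁ := hγle.trans (min_le_left _ _)
  have hγ1 : γ ≤ 1 := hγle.trans (min_le_right _ _)
  have hFL : 1 ≤ F.L := F.hL.2.le
  have hL0 : (0 : ℝ) < F.L := by exact_mod_cast lt_trans zero_lt_one F.hL.2
  have hL1 : (1 : ℝ) < F.L := by exact_mod_cast F.hL.2
  set θ := θBal F.L γ b₀ p₀ J with hθ_def
  have hθpos : 0 < θ := T3MinimiserStabilityReduction.θBal_pos hFL hγ hγ1 hb₀ p₀ J
  have hθc : B₃ * θ ≤ c := by
    have h := hθ γ hγ hγ₁' J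
    rw [← hF] at h
    rw [mul_comm]
    exact (le_div_iff₀ hB₃).mp h
  set x : ℝ := (F.L : ℝ)⁻¹ with hx_def
  have hx : 0 < x := inv_pos.mpr hL0
  have hx1 : x ≤ 1 := inv_le_one_of_one_le₀ hL1.le
  have hx2 : x ^ 2 < 1 := pow_lt_one₀ hx.le (inv_lt_one_of_one_lt₀ hL1) two_ne_zero
  refine ⟨fun n => C₂ * B₃ ^ 3 * θ ^ 3 * γ⁻¹ * (F.L : ℝ) ^ (3 * F.m + 4 * J) * (x ^ 2) ^ n, fun n => by positivity,
    (summable_geometric_of_lt_one (by positivity) hx2).mul_left _, fun K hJK U hU u' hu'8 _ => ?_⟩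
  -- the (8)-radius at depth `K + 1`
  have hPS : PlaqSmall (B₃ * θ * x ^ (2 * (K + 1 - J))) u' := ((mem_regFibrePr_iff F).mp hu'8).2.plaqSmall
  have ha : 0 < B₃ * θ * x ^ (2 * (K + 1 - J)) := by positivity
  have hac : B₃ * θ * x ^ (2 * (K + 1 - J)) ≤ c :=
    (mul_le_of_le_one_right (by positivity) (pow_le_one₀ hx.le hx1)).trans hθc
  have hstep := hcon F hF K _ ha hac u' hPS
  have hβ0 : 0 ≤ (F.scheme ℰp γ).β K := F.scheme_β_nonneg ℰp hγ.le K
  have hβs : (F.scheme ℰp γ).β (K + 1) = (F.L : ℝ) * (F.scheme ℰp γ).β K :=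
    Literature.MathematicalPhysics.QuantumFieldTheory.Balaban1983to89.T3LowerAlongMinimisersSplit.scheme_β_succ F γ K
  calc (F.scheme ℰp γ).β K * wilsonAction4 (descendTo F ℰp K (K + 1) (Nat.le_succ K) u')
      ≤ (F.scheme ℰp γ).β K * ((L : ℝ) * wilsonAction4 u' + C₂ * (B₃ * θ * x ^ (2 * (K + 1 - J))) ^ 3 * (L : ℝ) ^ (3 * (F.m + K))) :=
        mul_le_mul_of_nonneg_left hstep hβ0
    _ = (F.scheme ℰp γ).β (K + 1) * wilsonAction4 u' +
          (F.scheme ℰp γ).β K * (C₂ * (B₃ * θ * x ^ (2 * (K + 1 - J))) ^ 3 * (F.L : ℝ) ^ (3 * (F.m + K))) := by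
        rw [hβs, ← hF]; ring
    _ ≤ (F.scheme ℰp γ).β (K + 1) * wilsonAction4 u' +
          C₂ * B₃ ^ 3 * θ ^ 3 * γ⁻¹ * (F.L : ℝ) ^ (3 * F.m + 4 * J) * (x ^ 2) ^ (K - J) :=
        add_le_add le_rfl (beta_mul_cubic_le F hγ hC₂ hB₃.le hθpos.le hJK.le)

/-- D, DERIVED (v5). -/
theorem stub_depthActionIneq : DepthActionIneq :=
  depthActionIneq_of_contraction stub_contractionPackage

/-! ## §7e (v5, bonus for crux K1 / stmt-QuantumFields-19200) the tree's G-K1a-3b `AvgActionIneqAt` from D′ at the MOVING height -/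

open Literature.MathematicalPhysics.QuantumFieldTheory.Balaban1983to89.T3TiltDescent
  Literature.MathematicalPhysics.QuantumFieldTheory.Balaban1983to89.T3LowerAlongMinimisersSplit in
/-- **G-K1a-3b ⇐ D′** (PROVED; serves the LOWER stub of K1's child `MinimiserStabilityRegPr`, stmt-QuantumFields-19200): the per-configuration
contraction along the (8)-radius `a = B₃θ(⌊K/m⌋)·L^{−2(K+1−⌊K/m⌋)}` at the tree's moving height gives `T3LowerAlongMinimisersSplit.AvgActionIneqAt`
with `K₀ = 0` and the geometric radii `r_K = C₂B₃³L^{3m}γ⁻¹·(√(1/L))^K` for `m ≥ 10` (power counting `L^{4K}·L^{−6(K+1−k)} ≤ L^{4K−5(K−k)} ≤ L^{−K/2}`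
by `T3UpperLiftSplit.scale_product_le_sqrt_pow`; thresholds `θ ≤ min{1, c/B₃}` at every height by `exists_forall_θBal_le`).  So K1's LOWER direction
rests on `Prop1EmlAt ∧ AvgDivSmallAt ∧ D′` + print — D′ is ONE per-configuration schema for both roads. -/
theorem avgActionIneqAt_of_contraction {L : ℕ} {C₂ c B₃ : ℝ} (hC₂ : 0 ≤ C₂) (hc : 0 < c) (hB₃ : 0 < B₃)
    (hcon : AvgActionContractionAt L C₂ c) :
    ∀ m : ℕ, 10 ≤ m → ∀ b₀ p₀ : ℝ, 0 < b₀ → ∃ γ₁ : ℝ, 0 < γ₁ ∧ ∀ (F : T3Family) (γ : ℝ), F.L = L → 0 < γ → γ ≤ γ₁ →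
      ∀ ε₀ : ℝ, AvgActionIneqAt F γ b₀ p₀ m ε₀ B₃ := by
  intro m hm b₀ p₀ hb₀
  rcases Nat.lt_or_ge L 1 with hL | hL
  · exact ⟨1, one_pos, fun F γ hF _ _ _ => absurd F.hL.2 (by omega)⟩
  obtain ⟨γ₁, hγ₁, hθ⟩ := T3ThresholdSmallness.exists_forall_θBal_le hL b₀ p₀ (show 0 < min 1 (c / B₃) from lt_min one_pos (by positivity))
  refine ⟨min γ₁ 1, lt_min hγ₁ one_pos, fun F γ hF hγ hγle ε₀ => ?_⟩
  have hγ₁' : γ ≤ γ₁ := hγle.trans (min_le_left _ _)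
  have hγ1 : γ ≤ 1 := hγle.trans (min_le_right _ _)
  have hFL : 1 ≤ F.L := F.hL.2.le
  have hL0 : (0 : ℝ) < F.L := by exact_mod_cast lt_trans zero_lt_one F.hL.2
  have hL1 : (1 : ℝ) < F.L := by exact_mod_cast F.hL.2
  set x : ℝ := (F.L : ℝ)⁻¹ with hx_def
  have hx : 0 < x := inv_pos.mpr hL0
  have hx1 : x ≤ 1 := inv_le_one_of_one_le₀ hL1.le
  have hs : Real.sqrt x < 1 := (Real.sqrt_lt_sqrt hx.le (inv_lt_one_of_one_lt₀ hL1)).trans_eq Real.sqrt_one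
  refine ⟨0, fun K => C₂ * B₃ ^ 3 * γ⁻¹ * (F.L : ℝ) ^ (3 * F.m) * (Real.sqrt x) ^ K,
    (summable_geometric_of_lt_one (Real.sqrt_nonneg _) hs).mul_left _, fun K => by positivity, fun K _ V hV U' hU'8 _ => ?_⟩
  set k := K / m with hk_def
  set θ := θBal F.L γ b₀ p₀ k with hθ_def
  have hθpos : 0 < θ := T3MinimiserStabilityReduction.θBal_pos hFL hγ hγ1 hb₀ p₀ k
  have hθσ : θ ≤ min 1 (c / B₃) := by have h := hθ γ hγ hγ₁' k; rwa [← hF] at h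
  have hθ1 : θ ≤ 1 := hθσ.trans (min_le_left _ _)
  have hθc : B₃ * θ ≤ c := by
    rw [mul_comm]; exact (le_div_iff₀ hB₃).mp (hθσ.trans (min_le_right _ _))
  -- the (8)-radius at depth `K + 1` relative to the moving height `k`
  have hPS : PlaqSmall (B₃ * θ * x ^ (2 * (K + 1 - k))) U' := ((mem_regFibrePr_iff F).mp hU'8).2.plaqSmall
  have ha : 0 < B₃ * θ * x ^ (2 * (K + 1 - k)) := by positivity
  have hac : B₃ * θ * x ^ (2 * (K + 1 - k)) ≤ c :=
    (mul_le_of_le_one_right (by positivity) (pow_le_one₀ hx.le hx1)).trans hθc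
  have hstep := hcon F hF K _ ha hac U' hPS
  have hβ0 : 0 ≤ (F.scheme ℰp γ).β K := F.scheme_β_nonneg ℰp hγ.le K
  have hβs : (F.scheme ℰp γ).β (K + 1) = (F.L : ℝ) * (F.scheme ℰp γ).β K := scheme_β_succ F γ K
  have hβ : (F.scheme ℰp γ).β K = (γ * x ^ K)⁻¹ := rfl
  -- power counting at the moving height
  have hdef : (F.scheme ℰp γ).β K * (C₂ * (B₃ * θ * x ^ (2 * (K + 1 - k))) ^ 3 * (F.L : ℝ) ^ (3 * (F.m + K))) ≤
      C₂ * B₃ ^ 3 * γ⁻¹ * (F.L : ℝ) ^ (3 * F.m) * (Real.sqrt x) ^ K := by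
    have hLx : (F.L : ℝ) * x = 1 := mul_inv_cancel₀ hL0.ne'
    have e1 : (γ * x ^ K)⁻¹ = γ⁻¹ * (F.L : ℝ) ^ K := by rw [mul_inv, ← inv_pow, hx_def, inv_inv]
    have e2 : (B₃ * θ * x ^ (2 * (K + 1 - k))) ^ 3 = B₃ ^ 3 * θ ^ 3 * x ^ (6 * (K + 1 - k)) := by
      rw [mul_pow, mul_pow, ← pow_mul]; congr 1; ring_nf
    have hθ3 : θ ^ 3 ≤ 1 := pow_le_one₀ hθpos.le hθ1
    have h65 : x ^ (6 * (K + 1 - k)) ≤ x ^ (5 * (K - k)) := pow_le_pow_of_le_one hx.le hx1 (by omega)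
    have hscale := T3UpperLiftSplit.scale_product_le_sqrt_pow F hm K
    have key : (F.L : ℝ) ^ K * (F.L : ℝ) ^ (3 * (F.m + K)) * x ^ (6 * (K + 1 - k)) ≤ (F.L : ℝ) ^ (3 * F.m) * (Real.sqrt x) ^ K := by
      have h1 : (F.L : ℝ) ^ K * (F.L : ℝ) ^ (3 * (F.m + K)) * x ^ (6 * (K + 1 - k)) =
          (F.L : ℝ) ^ (3 * F.m) * (x ^ (6 * (K + 1 - k)) * (F.L : ℝ) ^ (4 * K)) := by ring
      rw [h1]
      refine mul_le_mul_of_nonneg_left ?_ (by positivity)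
      calc x ^ (6 * (K + 1 - k)) * (F.L : ℝ) ^ (4 * K) ≤ x ^ (5 * (K - k)) * (F.L : ℝ) ^ (4 * K) :=
            mul_le_mul_of_nonneg_right h65 (by positivity)
        _ ≤ (Real.sqrt x) ^ K := hscale
    calc (F.scheme ℰp γ).β K * (C₂ * (B₃ * θ * x ^ (2 * (K + 1 - k))) ^ 3 * (F.L : ℝ) ^ (3 * (F.m + K)))
        = C₂ * B₃ ^ 3 * γ⁻¹ * θ ^ 3 * ((F.L : ℝ) ^ K * (F.L : ℝ) ^ (3 * (F.m + K)) * x ^ (6 * (K + 1 - k))) := by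
          rw [hβ, e1, e2]; ring
      _ ≤ C₂ * B₃ ^ 3 * γ⁻¹ * 1 * ((F.L : ℝ) ^ (3 * F.m) * (Real.sqrt x) ^ K) :=
          mul_le_mul (mul_le_mul_of_nonneg_left hθ3 (by positivity)) key (by positivity) (by positivity)
      _ = C₂ * B₃ ^ 3 * γ⁻¹ * (F.L : ℝ) ^ (3 * F.m) * (Real.sqrt x) ^ K := by ring
  calc (F.scheme ℰp γ).β K * wilsonAction4 (descendTo F ℰp K (K + 1) (Nat.le_succ K) U')
      ≤ (F.scheme ℰp γ).β K * ((L : ℝ) * wilsonAction4 U' + C₂ * (B₃ * θ * x ^ (2 * (K + 1 - k))) ^ 3 * (L : ℝ) ^ (3 * (F.m + K))) :=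
        mul_le_mul_of_nonneg_left hstep hβ0
    _ = (F.scheme ℰp γ).β (K + 1) * wilsonAction4 U' +
          (F.scheme ℰp γ).β K * (C₂ * (B₃ * θ * x ^ (2 * (K + 1 - k))) ^ 3 * (F.L : ℝ) ^ (3 * (F.m + K))) := by
        rw [hβs, ← hF]; ring
    _ ≤ (F.scheme ℰp γ).β (K + 1) * wilsonAction4 U' + C₂ * B₃ ^ 3 * γ⁻¹ * (F.L : ℝ) ^ (3 * F.m) * (Real.sqrt x) ^ K :=
        add_le_add le_rfl hdef

/-! ## §7c (v4) M₁ DERIVED: the tree's LOWER composition at FIXED height — P⁺ (schemas by name) + D -/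

open Literature.MathematicalPhysics.QuantumFieldTheory.Balaban1983to89.T3TiltDescent
  Literature.MathematicalPhysics.QuantumFieldTheory.Balaban1983to89.T3LowerAlongMinimisersSplit in
/-- **M₁ ⇐ P⁺ ∧ D** (mirrors `T3LowerAlongMinimisersSplit.lowerAlongRegPrMinimisersAt_of_split` at fixed height): the competitor for the depth-`K`
problem is the one-step average of Thm 1's depth-`(K+1)` minimiser; it is admissible by `descendTo_mem_regFibrePr` (fibre tower ∧ `Prop1EmlAt` ∧
`AvgDivSmallAt`), the minimiser realises the depth-`(K+1)` infimum by `InfSixOfEightAt`, and D bounds the weighted actions; thresholds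
`θ ≤ min {a₁, ε₀/(2B₃), 1/(C₀B₃), c₂′/B₃}` at every height by `exists_forall_θBal_le`. -/
theorem depthMonotoneStep_of_package (hA : AveragingPackage) (hD : DepthActionIneq) : DepthMonotoneStep := by
  intro L b₀ p₀ hb₀ hp₀
  obtain ⟨a₀, a₁, B₃, C₀, c₂', ha₀, ha₁, hB₃, hC₀, hc₂, h8, h68, hP1, hdiv⟩ := hA L
  obtain ⟨ε₁D, hε₁D, hD⟩ := hD L b₀ p₀ B₃ hb₀ hp₀ hB₃
  refine ⟨min a₀ ε₁D, lt_min ha₀ hε₁D, fun ε₀ hε₀ hε₀le => ?_⟩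
  have hε₀a : ε₀ ≤ a₀ := hε₀le.trans (min_le_left _ _)
  obtain ⟨γD, hγD, hD⟩ := hD ε₀ hε₀ (hε₀le.trans (min_le_right _ _))
  rcases Nat.lt_or_ge L 1 with hL | hL
  · exact ⟨1, one_pos, fun F γ hF _ _ J => absurd F.hL.2 (by omega)⟩
  -- the target for the thresholds at every height
  set σ : ℝ := min a₁ (min (ε₀ / (2 * B₃)) (min (1 / (C₀ * B₃)) (c₂' / B₃))) with hσ_def
  have hσ : 0 < σ := lt_min ha₁ (lt_min (by positivity) (lt_min (by positivity) (by positivity)))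
  obtain ⟨γ₁, hγ₁, hθ⟩ := T3ThresholdSmallness.exists_forall_θBal_le hL b₀ p₀ hσ
  refine ⟨min (min γ₁ 1) γD, lt_min (lt_min hγ₁ one_pos) hγD, fun F γ hF hγ hγle J => ?_⟩
  have hγ₁' : γ ≤ γ₁ := hγle.trans ((min_le_left _ _).trans (min_le_left _ _))
  have hγ1 : γ ≤ 1 := hγle.trans ((min_le_left _ _).trans (min_le_right _ _))
  have hγD' : γ ≤ γD := hγle.trans (min_le_right _ _)
  obtain ⟨d, hd0, hds, hDJ⟩ := hD F γ hF hγ hγD' J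
  refine ⟨d, hd0, hds, fun K hJK U hU => ?_⟩
  -- `ε₁ := θ_J` and its four smallness conditions (as in the tree's composition)
  have hFL : 1 ≤ F.L := F.hL.2.le
  set ε₁ := θBal F.L γ b₀ p₀ J with hε₁_def
  have hε₁ : 0 < ε₁ := T3MinimiserStabilityReduction.θBal_pos hFL hγ hγ1 hb₀ p₀ J
  have hθσ : ε₁ ≤ σ := by rw [hε₁_def, hF]; exact hθ γ hγ hγ₁' J
  have hε₁a : ε₁ ≤ a₁ := hθσ.trans (min_le_left _ _)
  have hε₂ : ε₁ ≤ ε₀ / (2 * B₃) := hθσ.trans ((min_le_right _ _).trans (min_le_left _ _))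
  have hε₃ : ε₁ ≤ 1 / (C₀ * B₃) := hθσ.trans ((min_le_right _ _).trans ((min_le_right _ _).trans (min_le_left _ _)))
  have hε₄ : ε₁ ≤ c₂' / B₃ := hθσ.trans ((min_le_right _ _).trans ((min_le_right _ _).trans (min_le_right _ _)))
  have h2 : 2 * (B₃ * ε₁) ≤ ε₀ := by
    have h := mul_le_mul_of_nonneg_left hε₂ (by positivity : (0 : ℝ) ≤ 2 * B₃)
    rwa [mul_div_cancel₀ _ (by positivity : (2 : ℝ) * B₃ ≠ 0), show 2 * B₃ * ε₁ = 2 * (B₃ * ε₁) by ring] at h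
  have hlo : B₃ * ε₁ ≤ ε₀ := by nlinarith [mul_pos hB₃ hε₁]
  have hC : C₀ * (B₃ * ε₁) ≤ 1 := by
    have h := mul_le_mul_of_nonneg_left hε₃ (by positivity : (0 : ℝ) ≤ C₀ * B₃)
    rwa [mul_div_cancel₀ _ (by positivity : C₀ * B₃ ≠ 0), show C₀ * B₃ * ε₁ = C₀ * (B₃ * ε₁) by ring] at h
  have hc : B₃ * ε₁ ≤ c₂' := by
    have h := mul_le_mul_of_nonneg_left hε₄ hB₃.le
    rwa [mul_div_cancel₀ _ hB₃.ne'] at h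
  have hJK' : J < K + 1 := Nat.lt_succ_of_lt hJK
  -- Thm 1's depth-`(K+1)` minimiser in (8), minimising over (6)(ε₀) by G-K1aR-2
  obtain ⟨u', hu'8, hmin8⟩ := h8 F hF J (K + 1) hJK' ε₁ hε₁ hε₁a U hU
  have hmin := h68 F hF J (K + 1) hJK' ε₁ ε₀ hε₁ hε₁a hlo hε₀a U hU u' hu'8 hmin8
  have hval : wilsonAction4 u' = minActionRegPr F J (K + 1) hJK'.le ε₀ U :=
    T3PrintedMinimiserExistence.minActionRegPr_eq_of_isMinOn F
      (T3PrintedMinimiserExistence.regFibrePr_mono F hlo U hu'8) hmin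
  -- the competitor: its one-step average, admissible at depth `K`
  have hmem : descendTo F ℰp K (K + 1) (Nat.le_succ K) u' ∈ regFibrePr F J K hJK.le ε₀ U :=
    descendTo_mem_regFibrePr F hB₃ hP1 hdiv hF hJK hε₁ hε₁a hlo hε₀a hc hC h2 hU hu'8 hmin
  have hβ0 : 0 ≤ (F.scheme ℰp γ).β K := F.scheme_β_nonneg ℰp hγ.le K
  calc (F.scheme ℰp γ).β K * minActionRegPr F J K hJK.le ε₀ U
      ≤ (F.scheme ℰp γ).β K * wilsonAction4 (descendTo F ℰp K (K + 1) (Nat.le_succ K) u') :=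
        mul_le_mul_of_nonneg_left (minActionRegPr_le F hmem) hβ0
    _ ≤ (F.scheme ℰp γ).β (K + 1) * wilsonAction4 u' + d (K - J) := hDJ K hJK U hU u' hu'8 hmin
    _ = (F.scheme ℰp γ).β (K + 1) * minActionRegPr F J (K + 1) (Nat.le_succ_of_le hJK.le) ε₀ U + d (K - J) := by
        rw [hval]

/-- M₁, DERIVED (v4). -/
theorem stub_depthMonotoneStep : DepthMonotoneStep :=
  depthMonotoneStep_of_package stub_averagingPackage stub_depthActionIneq

/-! ## §8 DERIVED (v2): M and E from the plain stubs; S2α′ from the four stubs -/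

/-- M is DERIVED (v2) from the one-step stub M₁. -/
theorem stub_depthMonotone : DepthMonotoneRegPr :=
  depthMonotone_of_step stub_depthMonotoneStep

/-- E is DERIVED (v2, LINE g16-2) from the surgery table E-N + E-I + E-S. -/
theorem stub_depthEquicontinuous : DepthEquicontinuousRegPr :=
  depthEquicontinuous_of_surgery stub_regFibreHalfNonempty stub_interiorInfimum stub_competitorSurgery

/-- THE TWO TABLES COMPOSED (kernel-checked): M₁ → E-N → E-I → E-S → S2α′. -/
theorem classicalPerHeight_of_tables (h₁ : DepthMonotoneStep) (hN : RegFibreHalfNonempty) (hI : InteriorInfimum)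
    (hS : CompetitorSurgery) : ClassicalPerHeight :=
  classicalPerHeight_of_monotone_equicontinuous (depthMonotone_of_step h₁) (depthEquicontinuous_of_surgery hN hI hS)

/-- **THE v3 TABLE**: M₁ → P → E-S → S2α′ (three displayed inputs; P = tree schemas by name). -/
theorem classicalPerHeight_of_tables3 (h₁ : DepthMonotoneStep) (hP : PrintedMinimiserPackage) (hS : CompetitorSurgery) :
    ClassicalPerHeight :=
  classicalPerHeight_of_tables h₁ (regFibreHalfNonempty_of_package hP) (interiorInfimum_of_package hP) hS

/-- **THE v4 TABLE**: P⁺ → D → E-S → S2α′ (three displayed inputs: the books' schemas by name, the fixed-height action inequality, the surgery). -/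
theorem classicalPerHeight_of_tables4 (hA : AveragingPackage) (hD : DepthActionIneq) (hS : CompetitorSurgery) : ClassicalPerHeight :=
  classicalPerHeight_of_tables3 (depthMonotoneStep_of_package hA hD) (printedMinimiserPackage_of_averaging hA) hS

/-- **THE v5 TABLE**: P⁺ → D′ → E-S → S2α′ (books' schemas by name, the per-configuration averaging contraction, the surgery). -/
theorem classicalPerHeight_of_tables5 (hA : AveragingPackage) (hC : ContractionPackage) (hS : CompetitorSurgery) : ClassicalPerHeight :=
  classicalPerHeight_of_tables4 hA (depthActionIneq_of_contraction hC) hS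

/-- S2α′ (text verbatim = `RunPairOrgan.ClassicalPerHeight`) at the three registered stubs P⁺, D′, E-S; the leaf follows in the package as
`RunPairOrgan.yM3TorusSU2_of_classicalPerHeight` (v13). -/
theorem classicalPerHeight_of_stubs : ClassicalPerHeight :=
  classicalPerHeight_of_tables5 stub_averagingPackage stub_contractionPackage stub_competitorSurgery

end Summit.QuantumFields.YangMills.Cruxes.FluctuationComparisonRegPrIntL.RunPairOrgan.MonotoneDepth
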